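import Literature.Analysis.FluidPDE.HolderHalfDirectionCriterion
import Literature.Analysis.FluidPDE.AncientSimilarityVorticity
import Literature.Analysis.FluidPDE.TaoQuantitativeNonlinearEnergy
import Literature.Analysis.FluidPDE.PineauVicolWeightPositivity
import HarnessLib

/-!
# Near-Beltrami depletion coupled to the enstrophy rules out blow-up — whole space `ℝ³`, the
# global special case of Farhat–Grujić 2018, Theorem 1, PROVED (Constantin–Fefferman frame)

Analysis/FluidPDE proof file (theorems only: no definition, no named fact, no `sorry`). Typed for
the NavierStokesRegularity ideation cell (N0 door routes `LocalLambTubeDoor` (S12, born) and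
`LocalTubeDoorHelicity` (S11), whose `sources:` list arXiv:1804.08238 as nearest prior art): the
whole-space companion of `TorusNSNearBeltramiCriterion` (the same criterion on `T³` through the
Chae–Lee door), here in the frame of the tree's proved vorticity-direction criteria
`constantin_fefferman_holds` / `holderHalf_direction_criterion` (classical solutions on `ℝ³ × [0,T)`
in the Beale–Kato–Majda class, conclusion `HasSobolevExtensionPast`). A PUBLISHED conditional
criterion in its global form; nothing new about regularity.

## What is printed

A. Farhat, Z. Grujić, *Local near-Beltrami structure and depletion of the nonlinearity in the 3D
Navier–Stokes flows*, J. Nonlinear Sci. 29 (2019) 803–812 = arXiv:1804.08238 [FarhatGrujic2018]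
(held text `paper:arxiv-1804.08238`, chunks 3–6). §2: the vorticity equation "in the form suitable
for the study of local helicity" `ωₜ − Δω + ∇×(ω × u) = 0` (1); `α(t) := sup_{x ∈ B(x₀,2r)}
sin θ(x,t)`, `θ(x,t) := ∠(ω(x,t), u(x,t))`; `S_s := {y : |ω(y,s)| > M} ∩ B(x₀,2r)`.

> **Theorem 1.** Let `u` be a Leray–Hopf solution of the 3D NSE in `ℝ³ × (0,∞)` with initial
> data `u₀ ∈ L²(ℝ³)`. Given `(x₀,t₀) ∈ ℝ³ × (0,∞)` and `r > 0`, suppose that the flow is smooth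
> in the open cylinder `Q_{2r}(x₀,t₀)`, up to its parabolic boundary, and assume that there
> exists a constant `c` such that `α(s) ‖∇u(s)‖^{1/2}_{L²(S_s)} ≤ c` for every
> `s ∈ (t₀ − (2r)², t₀)`. Then the localized enstrophy remains bounded in `Q_r(x₀,t₀)` …
> and–consequently–`(x₀,t₀)` is a regular point.

Printed proof (pp. 4–6): multiply (1) by `ψ²ω` (cut-off `ψ` of `Q_{2r}`), move the curl onto
`ψ²ω` ((3)–(4)), split into low/high vorticity; on the high set
"`|I₂″| ≤ ∫∫ α(s)|u||ψω||∇×(ψω)| ≤ ∫ α(s)‖u‖_{L⁶(S_s)}‖ψω‖_{L³}‖∇(ψω)‖_{L²}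
≤ c ∫ α(s)‖∇u‖_{L²(S_s)}‖ψω‖₂^{1/2}‖∇(ψω)‖₂^{3/2}`" ("Hölder's inequality w.r.t. `y`, Sobolev
embedding and Ladyzhenskaya's inequality"), Hölder in `s`, Young, absorption through
`‖∇u‖_{L²(Q_{2r})} → 0` as `r → 0`.

## What is typed here, and what is not (faithfulness)

Typed: the **GLOBAL special case `r = ∞`** of Theorem 1 on the whole space — `ψ ≡ 1` (no
boundary terms `I₁, I₃`), `S_s` and `B(x₀,2r)` both replaced by `ℝ³` (so the hypothesis
`α(s)‖∇u(s)‖^{1/2}_{L²(ℝ³)} ≤ c` is STRONGER and the theorem WEAKER than print), `M = 0` — for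
classical solutions in the Beale–Kato–Majda class (every deviation from print — smooth instead of
Leray–Hopf, continuation in the class instead of "regular point" — weakens the statement, exactly as
in the tree's `constantin_fefferman` / `holderHalf_direction_criterion`):

* `FarhatGrujic2018.integral_inner_curl_eq_integral_inner_curl_of_integrable` — the curl is
  self-adjoint on integrable pairs (the step (3) with `ψ ≡ 1`, no compact support);
* `FarhatGrujic2018.integral_norm_pow_six_le` — `H¹ ⊂ L⁶` on `ℝ³` in integral form;
* `FarhatGrujic2018.integral_stretching_eq_integral_inner_curl_cross` — the LAMB FORM of the
  vortex stretching, `∫⟪ω, (∇v)ω⟫ = ∫⟪curl ω, v × ω⟫` for divergence-free `C²` fields with the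
  natural bounds (identity (1)/(3)–(4): `(ω·∇)v = (v·∇)ω − curl(ω × v)`, the transport term
  integrates to zero, the curl moves onto `ω × v`);
* `FarhatGrujic2018.stretching_count` — the real-variable count (two weighted AM–GM steps);
* `FarhatGrujic2018.two_mul_integral_stretching_le_of_nearBeltrami` /
  `….exists_two_mul_integral_stretching_le_of_nearBeltrami` — the FIXED-TIME estimate
  `2∫⟪ω,(∇v)ω⟫ ≤ ν∫|∇ω|²_F + (2κ⁴K₀⁶c⁴/ν³)(∫|ω|²)²` under `|v × ω| ≤ a|v||ω|`, `a⁴∫|∇v|²_F ≤ c⁴`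
  (the printed chain: Cauchy–Schwarz, Hölder `(3, 3/2)`, Sobolev twice, Cauchy–Schwarz twice for
  `‖ω‖₃² ≤ K₀‖ω‖₂‖∇ω‖₂`, Young twice; plus `∫|∇v|²_F ≤ ∫|ω|²` for divergence-free `v`), in the
  shape consumed by the tree's slab Grönwall `integral_sq_norm_curl_le_of_direction_slab`;
* `exists_uniform_H1_bound_of_nearBeltrami` — the a priori `H¹` bound on `[0, T)` (Tao's energy
  class + the slab Grönwall; the energy dissipation `∫∫|∇u|² ≤ E₀/ν` replaces the printed `r → 0`
  absorption, which has no global counterpart);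
* `nearBeltrami_enstrophy_criterion` — **Theorem 1, global special case, continuation form**:
  `sin∠(u,ω)(x,t) ≤ a(t)` for all `x` (as `|u × ω| ≤ a(t)|u||ω|`) and `a(t)‖∇u(t)‖₂^{1/2} ≤ c`
  for all `t ∈ [0,T)` (ANY constant `c`, as printed — no smallness) ⇒
  `HasSobolevExtensionPast ν u T`;
* `nearBeltrami_enstrophy_criterion_of_late` — the same with the hypothesis only on a final time
  window `[t₀, T)` (the printed hypothesis bears on `s ∈ (t₀ − (2r)², t₀)`);
* `FarhatGrujic2018.two_mul_integral_stretching_le_of_nearBeltrami_threshold` /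
  `….exists_two_mul_integral_stretching_le_of_nearBeltrami_threshold`,
  `exists_uniform_H1_bound_of_nearBeltrami_threshold`, `nearBeltrami_enstrophy_criterion_threshold`
  (+ `_of_late`) — the THRESHOLD form: the angle bound is required only in the printed regions of
  intense vorticity `S = {|ω| > M}` (`M ≥ 0`), on which alone the printed proof uses it (estimate of
  `I₂″`); on `{|ω| ≤ M}` the Lamb pairing is bounded angle-free through
  `∫_{|ω|≤M}|ω|³ ≤ M∫|ω|²` (so that, unlike the printed `I₂′`, no `‖u‖₂` term appears and the
  estimate stays in the shape of the slab Grönwall: `C₁ = 2κ²K₀²/(3ν)`,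
  `C₂ = 16κ⁴K₀⁶c⁴/ν³ + 4κ²K₀²M/(3ν)`).

NOT typed (scope): (i) the LOCAL statement of Theorem 1 itself (parabolic cylinder, Leray–Hopf
class, "regular point") — the tree has no localized enstrophy machinery on `ℝ³` (cf. the fact
`grujic2009_localized_halfHolder_coherence`), and the printed localized proof bounds
`‖u‖_{L⁶(S_s)}` by `c‖∇u‖_{L²(S_s)}` on the high-vorticity set `S_s` (p. 5, estimates of `I₂″` and
`I₃″`), a Sobolev inequality on an arbitrary open set that we could not justify as printed (the
argument goes through with `L²(B(x₀,2r))` norms of `∇u` and `u`, i.e. for a weaker statement); it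
is therefore NOT vendored as a named fact; (ii) the coupling constant restricted to the
high-vorticity set, `α(s)‖∇u(s)‖^{1/2}_{L²(S_s)}` — the chain needs the FULL `‖∇u(s)‖_{L²(ℝ³)}`
(through `‖u‖_{L⁶} ≤ K₀‖∇u‖_{L²(ℝ³)}`), which is exactly the printed gap of (i).
-- TODO(general form): Theorem 1 as printed (local, `Q_{2r}(x₀,t₀)`).

Relation to the tree: the `T³` version is `Torus.classicalNS_continuation_of_nearBeltrami_enstrophy`
(`TorusNSNearBeltramiCriterion`); the ORTHOGONAL end `u ⟂ ω` is the proved Berselli–Córdoba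
criterion `Torus.classicalNS_continuation_of_velocity_orthogonal_vorticity`; the vorticity-DIRECTION
criteria of the same frame are `constantin_fefferman_holds`, `holderHalf_direction_criterion`,
`grujicRuzmaikina2004_hybrid_direction_criterion_holds`.

## Mathlib / tree search

Tree (used): `integral_sq_norm_curl_le_of_direction_slab` (`ConstantinFeffermanEnstrophySlab`),
`hasSobolevExtensionPast_of_uniform_H1_bound` (`H1ContinuationSobolevClass`),
`tao_finite_energy_smooth_energy_bound_holds`, `linfty_bound_of_hasBoundedSobolevNormsOn_holds`,
`exists_forall_norm_fderiv_le_of_hasBoundedSobolevNormsOn`, `curl_cross_apply`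
(`AncientSimilarityVorticity`), `integral_inner_convect_transport_eq_zero`
(`TaoQuantitativeNonlinearEnergy`), `PineauVicol2026.integral_divergence_eq_zero_of_integrable`,
`divergence_cross_holds`, `divergence_curl_eq_zero_holds`, `eLpNorm_six_le_eLpNorm_fderiv_two`
(`SobolevWholeSpace`), `lintegral_frobeniusNormSq_fderiv_le_lintegral_sq_norm_curl`,
`integral_norm_mul_norm_le_sqrt`, `toReal_eLpNorm_two_eq_sqrt`, `two_mul_mul_le_add_sq`,
`norm_curl_le`, `fderiv_curl`, `sq_opNorm_le_frobeniusNormSq`, `cross_swap`, `norm_cross`.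
Mathlib: `integral_mul_le_Lp_mul_Lq_of_nonneg` (Hölder `(3, 3/2)`), `integrable_norm_rpow_iff`,
`MemLp.eLpNorm_eq_integral_rpow_norm`, `Real.rpow_le_rpow`, `Real.rpow_mul`. Searched
(`lean search`): `Farhat|nearBeltrami|lamb.*criterion|cross .* curl .* stretching` — no near-Beltrami
/ Lamb-vector criterion on `ℝ³` in the tree (the `T³` file of this seat aside) — added here.

## References

* [FarhatGrujic2018] A. Farhat, Z. Grujić, J. Nonlinear Sci. 29 (2019) 803–812,
  doi:10.1007/s00332-018-9504-8, arXiv:1804.08238 — §2 Theorem 1 (p. 4) and its proof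
  (pp. 4–6: (1), (3)–(5), the estimates of `I₂′, I₂″, I₃′, I₃″`).
* [ConstantinFeffermanIndiana1993] P. Constantin, C. Fefferman, Indiana Univ. Math. J. 42 (1993)
  775–789 (the frame and the enstrophy Grönwall; tree `constantin_fefferman_holds`).
* [MajdaBertozziCUP2002] A. Majda, A. Bertozzi, *Vorticity and Incompressible Flow*, CUP 2002,
  §1.1 (vector identities: `curl (W × Ω)`, `div (Ψ × F)`).
* [Tao2011] T. Tao, *Localisation and compactness properties of the Navier–Stokes global regularity
  problem*, Anal. PDE 6 (2013), Lemma 8.1 (energy class).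
-/

noncomputable section

open MeasureTheory Set Function Filter Metric Real InnerProductSpace
open _root_.Topology
open scoped ENNReal NNReal RealInnerProductSpace ContDiff

namespace Literature.Analysis.FluidPDE

-- nested operator types (second derivatives)
set_option maxSynthPendingDepth 3

namespace FarhatGrujic2018

/-! ### §1 Tools: the curl is self-adjoint on integrable pairs; `H¹ ⊂ L⁶` in integral form -/

/-- **Integration by parts for the curl without compact support**: for `C¹` fields `F, Ψ` on
`ℝ³` with `Ψ × F` integrable and both pairings `⟪F, curl Ψ⟫`, `⟪Ψ, curl F⟫` integrable,
`∫ ⟪curl F, Ψ⟫ = ∫ ⟪F, curl Ψ⟫` (`div (Ψ × F) = ⟪F, curl Ψ⟫ − ⟪Ψ, curl F⟫` and `∫ div = 0` for an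
integrable `C¹` field with integrable divergence). This is the step
"`∫ ∇×(ω×u)·(ψ²ω) = ∫ (ω×u)·(∇×(ψ²ω))`" of the printed proof, (3), with `ψ ≡ 1`.
[cite: FarhatGrujic2018, §2, proof of Thm 1, identity (3) and the curl identity before it] -/
theorem integral_inner_curl_eq_integral_inner_curl_of_integrable
    {F Ψ : EuclideanSpace ℝ (Fin 3) → EuclideanSpace ℝ (Fin 3)} (hF : ContDiff ℝ 1 F)
    (hΨ : ContDiff ℝ 1 Ψ) (hX : Integrable fun y => cross (Ψ y) (F y))
    (h1 : Integrable fun y => ⟪F y, curl Ψ y⟫) (h2 : Integrable fun y => ⟪Ψ y, curl F y⟫) :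
    ∫ x, ⟪curl F x, Ψ x⟫ = ∫ x, ⟪F x, curl Ψ x⟫ := by
  have hXc : ContDiff ℝ 1 fun y => cross (Ψ y) (F y) :=
    (crossCLM.contDiff.comp hΨ).clm_apply hF
  have hpt : ∀ x, VectorCalculus.divergence (fun y => cross (Ψ y) (F y)) x =
      ⟪F x, curl Ψ x⟫ - ⟪Ψ x, curl F x⟫ :=
    fun x => divergence_cross_holds Ψ F x (hΨ.differentiable one_ne_zero x)
      (hF.differentiable one_ne_zero x)
  have hdi : Integrable fun x => VectorCalculus.divergence (fun y => cross (Ψ y) (F y)) x := by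
    have : (fun x => VectorCalculus.divergence (fun y => cross (Ψ y) (F y)) x) =
        fun x => ⟪F x, curl Ψ x⟫ - ⟪Ψ x, curl F x⟫ := funext hpt
    rw [this]; exact h1.sub h2
  have h0 := PineauVicol2026.integral_divergence_eq_zero_of_integrable hXc hX hdi
  simp_rw [hpt] at h0
  rw [integral_sub h1 h2, sub_eq_zero] at h0
  rw [h0]
  exact integral_congr_ae (Eventually.of_forall fun x => real_inner_comm _ _)

/-- **`H¹ ⊂ L⁶` on `ℝ³` in integral form** ("Sobolev embedding", printed proof p. 5): for a `C¹`
field `w` with `w, ∇w ∈ L²` and `|w|⁶` integrable, `∫ |w|⁶ ≤ (K₀ ‖∇w‖₂)⁶` with the tree's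
Gagliardo–Nirenberg–Sobolev constant `K₀` (`eLpNorm_six_le_eLpNorm_fderiv_two`).
[cite: FarhatGrujic2018, Thm 1 (proof p. 5, "Sobolev embedding")] -/
theorem integral_norm_pow_six_le {w : EuclideanSpace ℝ (Fin 3) → EuclideanSpace ℝ (Fin 3)}
    (hw : ContDiff ℝ 1 w) (h2 : Integrable fun x => ‖w x‖ ^ 2)
    (hD : Integrable fun x => ‖fderiv ℝ w x‖ ^ 2) (h6 : Integrable fun x => ‖w x‖ ^ 6) :
    ∫ x, ‖w x‖ ^ 6 ≤
      ((SNormLESNormFDerivOfEqConst (EuclideanSpace ℝ (Fin 3))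
          (volume : Measure (EuclideanSpace ℝ (Fin 3))) 2 : ℝ) *
        Real.sqrt (∫ x, ‖fderiv ℝ w x‖ ^ 2)) ^ 6 := by
  set K₀ : ℝ≥0 := SNormLESNormFDerivOfEqConst (EuclideanSpace ℝ (Fin 3))
    (volume : Measure (EuclideanSpace ℝ (Fin 3))) 2 with hK₀
  have hwc : Continuous w := hw.continuous
  have hDc : Continuous (fderiv ℝ w) := hw.continuous_fderiv one_ne_zero
  have hm2 : MemLp w 2 volume := (memLp_two_iff_integrable_sq_norm hwc.aestronglyMeasurable).2 h2
  have hm6 : MemLp w 6 volume := by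
    refine (integrable_norm_rpow_iff hwc.aestronglyMeasurable (by norm_num) (by norm_num)).1 ?_
    refine h6.congr (Eventually.of_forall fun x => ?_)
    simp only [ENNReal.toReal_ofNat]
    rw [show (6 : ℝ) = ((6 : ℕ) : ℝ) by norm_num, Real.rpow_natCast]
  have hsob := eLpNorm_six_le_eLpNorm_fderiv_two (volume : Measure (EuclideanSpace ℝ (Fin 3)))
    (F := EuclideanSpace ℝ (Fin 3)) finrank_euclideanSpace_fin hw hm2.eLpNorm_lt_top
  -- the two norms as real numbers
  set I6 : ℝ := ∫ x, ‖w x‖ ^ 6 with hI6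
  have hI60 : 0 ≤ I6 := integral_nonneg fun x => by positivity
  have e6 : eLpNorm w 6 volume = ENNReal.ofReal (I6 ^ ((6 : ℝ)⁻¹)) := by
    rw [MemLp.eLpNorm_eq_integral_rpow_norm (by norm_num) (by norm_num) hm6, ENNReal.toReal_ofNat]
    have hint : ∫ x, ‖w x‖ ^ (6 : ℝ) = I6 := integral_congr_ae (Eventually.of_forall fun x => by
      simp only
      rw [show (6 : ℝ) = ((6 : ℕ) : ℝ) by norm_num, Real.rpow_natCast])
    simp only [hint]
  have e2 : eLpNorm (fderiv ℝ w) 2 volume = ENNReal.ofReal (Real.sqrt (∫ x, ‖fderiv ℝ w x‖ ^ 2)) := by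
    have hmD : MemLp (fderiv ℝ w) 2 volume :=
      (memLp_two_iff_integrable_sq_norm hDc.aestronglyMeasurable).2 hD
    rw [← toReal_eLpNorm_two_eq_sqrt hDc hD, ENNReal.ofReal_toReal hmD.eLpNorm_lt_top.ne]
  rw [e6, e2, ← ENNReal.ofReal_coe_nnreal, ← ENNReal.ofReal_mul (NNReal.coe_nonneg _)] at hsob
  have hle : I6 ^ ((6 : ℝ)⁻¹) ≤ (K₀ : ℝ) * Real.sqrt (∫ x, ‖fderiv ℝ w x‖ ^ 2) :=
    (ENNReal.ofReal_le_ofReal_iff (by positivity)).1 hsob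
  have h := pow_le_pow_left₀ (Real.rpow_nonneg hI60 _) hle 6
  have hid : (I6 ^ ((6 : ℝ)⁻¹)) ^ (6 : ℕ) = I6 := by
    rw [← Real.rpow_natCast, ← Real.rpow_mul hI60]; norm_num
  rwa [hid] at h


/-! ### §2 Pointwise tools -/

/-- `‖a × b‖ ≤ ‖a‖ ‖b‖` (`‖a × b‖ = ‖a‖‖b‖ sin∠(a,b)`). (Proof device.) [folklore] -/
private theorem norm_cross_le' (a b : EuclideanSpace ℝ (Fin 3)) : ‖cross a b‖ ≤ ‖a‖ * ‖b‖ := by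
  rw [norm_cross]
  exact mul_le_of_le_one_right (by positivity) (Real.sin_le_one _)

/-- **The real-variable count of the near-Beltrami stretching estimate** (the printed chain
"`≤ c α(s)‖∇u‖_{L²}‖ψω‖₂^{1/2}‖∇(ψω)‖₂^{3/2}`" followed by Young's inequality, p. 5): if
`T ≤ 2a·(κ√D)·√M`, `M ≤ K³F√Y√D`, `a⁴F ≤ c⁴` and `F ≤ Y` (all quantities non-negative, `ν > 0`),
then `T ≤ νD + (2κ⁴K⁶c⁴/ν³)·Y·Y`. (Proof device: two weighted AM–GM steps.)
[cite: FarhatGrujic2018, Thm 1 (proof p. 5: Hölder in y, Sobolev, Ladyzhenskaya, Young)] -/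
theorem stretching_count {ν κ K a c T M Y D F : ℝ} (hν : 0 < ν) (hκ : 0 ≤ κ) (hK : 0 ≤ K)
    (ha : 0 ≤ a) (hY : 0 ≤ Y) (hD : 0 ≤ D) (hF : 0 ≤ F)
    (hT : T ≤ 2 * a * (κ * Real.sqrt D) * Real.sqrt M)
    (hM : M ≤ K ^ 3 * F * Real.sqrt Y * Real.sqrt D) (hcpl : a ^ 4 * F ≤ c ^ 4) (hFY : F ≤ Y) :
    T ≤ ν * D + 2 * κ ^ 4 * K ^ 6 * c ^ 4 / ν ^ 3 * Y * Y := by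
  set sY := Real.sqrt Y with hsY
  set sD := Real.sqrt D with hsD
  have hsY0 : 0 ≤ sY := Real.sqrt_nonneg _
  have hsD0 : 0 ≤ sD := Real.sqrt_nonneg _
  have hsY2 : sY ^ 2 = Y := Real.sq_sqrt hY
  have hsD2 : sD ^ 2 = D := Real.sq_sqrt hD
  -- `s = (Y D)^{1/4}`
  set s : ℝ := Real.sqrt (sY * sD) with hs
  have hs0 : 0 ≤ s := Real.sqrt_nonneg _
  have hs2 : s ^ 2 = sY * sD := Real.sq_sqrt (mul_nonneg hsY0 hsD0)
  -- `√M ≤ √(K³F) · s`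
  have hKF0 : 0 ≤ K ^ 3 * F := by positivity
  have hsM : Real.sqrt M ≤ Real.sqrt (K ^ 3 * F) * s := by
    rw [hs, ← Real.sqrt_mul hKF0]
    exact Real.sqrt_le_sqrt (by rw [← mul_assoc]; exact hM)
  -- `T ≤ A₁ s √D` with `A₁ = 2aκ√(K³F)`
  set A₁ : ℝ := 2 * a * κ * Real.sqrt (K ^ 3 * F) with hA₁
  have hA₁0 : 0 ≤ A₁ := by positivity
  have hT1 : T ≤ A₁ * s * sD := by
    calc T ≤ 2 * a * (κ * sD) * Real.sqrt M := hT
      _ ≤ 2 * a * (κ * sD) * (Real.sqrt (K ^ 3 * F) * s) :=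
          mul_le_mul_of_nonneg_left hsM (by positivity)
      _ = A₁ * s * sD := by rw [hA₁]; ring
  -- first AM–GM: `A₁ s √D ≤ (ν/2) D + A₁² s²/(2ν)`
  have hag1 : A₁ * s * sD ≤ ν / 2 * D + A₁ ^ 2 * s ^ 2 / (2 * ν) := by
    have h := two_mul_mul_le_add_sq hν sD (A₁ * s / 2)
    have e1 : 2 * (sD * (A₁ * s / 2)) = A₁ * s * sD := by ring
    have e2 : ν / 2 * sD ^ 2 + 2 / ν * (A₁ * s / 2) ^ 2 = ν / 2 * D + A₁ ^ 2 * s ^ 2 / (2 * ν) := by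
      rw [hsD2]; field_simp
    linarith [h, e1, e2]
  -- second AM–GM: `A₁² s²/(2ν) = (A₁²/(2ν)) √Y √D ≤ (ν/2) D + A₁⁴ Y/(8ν³)`
  have hag2 : A₁ ^ 2 * s ^ 2 / (2 * ν) ≤ ν / 2 * D + A₁ ^ 4 * Y / (8 * ν ^ 3) := by
    rw [hs2]
    have h := two_mul_mul_le_add_sq hν sD (A₁ ^ 2 * sY / (4 * ν))
    have e1 : 2 * (sD * (A₁ ^ 2 * sY / (4 * ν))) = A₁ ^ 2 * (sY * sD) / (2 * ν) := by
      field_simp; ring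
    have e2 : ν / 2 * sD ^ 2 + 2 / ν * (A₁ ^ 2 * sY / (4 * ν)) ^ 2 =
        ν / 2 * D + A₁ ^ 4 * Y / (8 * ν ^ 3) := by
      rw [hsD2, div_pow, mul_pow, ← pow_mul, hsY2]; field_simp; ring
    linarith [h, e1, e2]
  -- `A₁⁴ = 16 a⁴ κ⁴ K⁶ F²` and the coupling
  have hA₁4 : A₁ ^ 4 = 16 * (a ^ 4 * F) * F * κ ^ 4 * K ^ 6 := by
    rw [hA₁]
    have h4 : Real.sqrt (K ^ 3 * F) ^ 4 = (K ^ 3 * F) ^ 2 := by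
      rw [show (4 : ℕ) = 2 * 2 from rfl, pow_mul, Real.sq_sqrt hKF0]
    calc (2 * a * κ * Real.sqrt (K ^ 3 * F)) ^ 4 = 2 ^ 4 * a ^ 4 * κ ^ 4 * Real.sqrt (K ^ 3 * F) ^ 4 := by
          ring
      _ = 16 * (a ^ 4 * F) * F * κ ^ 4 * K ^ 6 := by rw [h4]; ring
  have hfin : A₁ ^ 4 * Y / (8 * ν ^ 3) ≤ 2 * κ ^ 4 * K ^ 6 * c ^ 4 / ν ^ 3 * Y * Y := by
    rw [hA₁4]
    have hν3 : 0 < ν ^ 3 := pow_pos hν 3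
    have h1 : 16 * (a ^ 4 * F) * F * κ ^ 4 * K ^ 6 * Y ≤ 16 * c ^ 4 * Y * κ ^ 4 * K ^ 6 * Y := by
      have : (a ^ 4 * F) * F ≤ c ^ 4 * Y := mul_le_mul hcpl hFY hF (by positivity)
      nlinarith [mul_nonneg (mul_nonneg (pow_nonneg hκ 4) (pow_nonneg hK 6)) hY]
    rw [div_le_iff₀ (by positivity)]
    have e : 2 * κ ^ 4 * K ^ 6 * c ^ 4 / ν ^ 3 * Y * Y * (8 * ν ^ 3) =
        16 * c ^ 4 * Y * κ ^ 4 * K ^ 6 * Y := by field_simp; ring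
    rw [e]; exact h1
  linarith [hT1, hag1, hag2, hfin]

/-! ### §3 The Lamb-vector form of the vortex-stretching integral -/

/-- **The stretching integral in Lamb-vector form** (the printed identity behind (1) and (3)–(4),
`ψ ≡ 1`: `∫ (ω·∇)u·ω = −∫ ∇×(ω×u)·ω = −∫ (ω×u)·(∇×ω)`): for a divergence-free `C²` field `v` on
`ℝ³`, bounded with bounded gradient, `∇v ∈ L²` and `∇²v ∈ L²`, with `ω = curl v`,
`∫ ⟪ω, (∇v) ω⟫ = ∫ ⟪curl ω, v × ω⟫`. Steps: `(ω·∇)v = (v·∇)ω − curl(ω × v)` pointwise (the tree's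
`curl_cross_apply` with `div v = div ω = 0`); `∫⟪(v·∇)ω, ω⟫ = 0`
(`integral_inner_convect_transport_eq_zero`); the curl is self-adjoint on the integrable pair
`(ω, ω × v)` (`integral_inner_curl_eq_integral_inner_curl_of_integrable`); `ω × v = −(v × ω)`.
[cite: FarhatGrujic2018, §2 eq. (1) and identities (3)–(4) (with ψ ≡ 1); MajdaBertozziCUP2002, §1.1 (vector identities)] -/
theorem integral_stretching_eq_integral_inner_curl_cross
    {v : EuclideanSpace ℝ (Fin 3) → EuclideanSpace ℝ (Fin 3)} (hv : ContDiff ℝ 2 v)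
    (hdiv : VectorCalculus.IsDivFree v) {B₀ : ℝ} (hB₀ : ∀ x, ‖v x‖ ≤ B₀) {B₁ : ℝ}
    (hB₁ : ∀ x, ‖fderiv ℝ v x‖ ≤ B₁) (hG : Integrable fun x => ‖fderiv ℝ v x‖ ^ 2)
    (hH : Integrable fun x => ‖fderiv ℝ (fderiv ℝ v) x‖ ^ 2) :
    ∫ x, ⟪curl v x, fderiv ℝ v x (curl v x)⟫ =
      ∫ x, ⟪curl (curl v) x, cross (v x) (curl v x)⟫ := by
  -- ### basic objects
  have hv1 : ContDiff ℝ 1 v := hv.of_le (by norm_num)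
  have hvc : Continuous v := hv.continuous
  have hDv : Continuous (fderiv ℝ v) := hv.continuous_fderiv (by norm_num)
  have hω1 : ContDiff ℝ 1 (curl v) := contDiff_curl (n := 1) (by exact hv)
  have hωc : Continuous (curl v) := hω1.continuous
  have hDω : Continuous (fderiv ℝ (curl v)) := hω1.continuous_fderiv one_ne_zero
  have hB₀0 : 0 ≤ B₀ := (norm_nonneg _).trans (hB₀ 0)
  have hB₁0 : 0 ≤ B₁ := (norm_nonneg _).trans (hB₁ 0)
  have hωle : ∀ x, ‖curl v x‖ ≤ ‖curlCLM‖ * ‖fderiv ℝ v x‖ := fun x => norm_curl_le v x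
  have hωbd : ∀ x, ‖curl v x‖ ≤ ‖curlCLM‖ * B₁ := fun x =>
    (hωle x).trans (mul_le_mul_of_nonneg_left (hB₁ x) (norm_nonneg _))
  have hDωle : ∀ x, ‖fderiv ℝ (curl v) x‖ ≤ ‖curlCLM‖ * ‖fderiv ℝ (fderiv ℝ v) x‖ := fun x => by
    rw [fderiv_curl hv]
    exact ContinuousLinearMap.opNorm_comp_le _ _
  have hcωle : ∀ x, ‖curl (curl v) x‖ ≤ ‖curlCLM‖ * ‖fderiv ℝ (curl v) x‖ :=
    fun x => norm_curl_le (curl v) x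
  -- ### integrability
  have Iω : Integrable fun x => ‖curl v x‖ ^ 2 := by
    refine (hG.const_mul (‖curlCLM‖ ^ 2)).mono' ((hωc.norm.pow 2).aestronglyMeasurable)
      (Eventually.of_forall fun x => ?_)
    rw [Real.norm_of_nonneg (sq_nonneg _), ← mul_pow]
    exact pow_le_pow_left₀ (norm_nonneg _) (hωle x) 2
  have IDω : Integrable fun x => ‖fderiv ℝ (curl v) x‖ ^ 2 := by
    refine (hH.const_mul (‖curlCLM‖ ^ 2)).mono' ((hDω.norm.pow 2).aestronglyMeasurable)
      (Eventually.of_forall fun x => ?_)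
    rw [Real.norm_of_nonneg (sq_nonneg _), ← mul_pow]
    exact pow_le_pow_left₀ (norm_nonneg _) (hDωle x) 2
  have hω2 : MemLp (curl v) 2 volume := (memLp_two_iff_integrable_sq_norm hωc.aestronglyMeasurable).2 Iω
  have hDω2 : MemLp (fun x => fderiv ℝ (curl v) x) 2 volume :=
    (memLp_two_iff_integrable_sq_norm hDω.aestronglyMeasurable).2 IDω
  -- the basic integrable products `‖ω‖‖∇ω‖` and `‖ω‖²`
  have Iprod : Integrable fun x => ‖curl v x‖ * ‖fderiv ℝ (curl v) x‖ :=
    hω2.norm.integrable_mul hDω2.norm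
  -- ### the pointwise identity `(ω·∇)v = (v·∇)ω − curl(ω × v)`
  have hpt : ∀ x, fderiv ℝ v x (curl v x) =
      convect v (curl v) x - curl (fun y => cross (curl v y) (v y)) x := by
    intro x
    have h := curl_cross_apply (W := curl v) (Ω := v) (x := x)
      (hω1.differentiable one_ne_zero x) (hv.differentiable (by norm_num) x)
    rw [divergence_curl_eq_zero_holds v hv x, hdiv x, zero_smul, zero_smul, sub_zero, add_zero] at h
    rw [h, convect]
    abel
  -- the curl of `ω × v` is bounded by `B₀|∇ω| + B₁|ω|`
  have hcurlX : ∀ x, ‖curl (fun y => cross (curl v y) (v y)) x‖ ≤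
      B₀ * ‖fderiv ℝ (curl v) x‖ + B₁ * ‖curl v x‖ := by
    intro x
    have e : curl (fun y => cross (curl v y) (v y)) x = convect v (curl v) x - fderiv ℝ v x (curl v x) := by
      rw [hpt x]; abel
    rw [e]
    refine (norm_sub_le _ _).trans (add_le_add ?_ ?_)
    · rw [convect]
      calc ‖fderiv ℝ (curl v) x (v x)‖ ≤ ‖fderiv ℝ (curl v) x‖ * ‖v x‖ := ContinuousLinearMap.le_opNorm _ _
        _ ≤ ‖fderiv ℝ (curl v) x‖ * B₀ := mul_le_mul_of_nonneg_left (hB₀ x) (norm_nonneg _)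
        _ = B₀ * ‖fderiv ℝ (curl v) x‖ := mul_comm _ _
    · calc ‖fderiv ℝ v x (curl v x)‖ ≤ ‖fderiv ℝ v x‖ * ‖curl v x‖ := ContinuousLinearMap.le_opNorm _ _
        _ ≤ B₁ * ‖curl v x‖ := mul_le_mul_of_nonneg_right (hB₁ x) (norm_nonneg _)
  -- ### Term A: the transport term vanishes
  have hA : ∫ x, ⟪curl v x, convect v (curl v) x⟫ = 0 := by
    have h := integral_inner_convect_transport_eq_zero hv1 hdiv hB₀ hω1 hω2 hDω2
    rw [← h]
    exact integral_congr_ae (Eventually.of_forall fun x => real_inner_comm _ _)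
  -- ### Term B: the curl moves onto `ω × v`
  have hΨ1 : ContDiff ℝ 1 fun y => cross (curl v y) (v y) :=
    (crossCLM.contDiff.comp hω1).clm_apply hv1
  have hΨc : Continuous fun y => cross (curl v y) (v y) := hΨ1.continuous
  have hB : ∫ x, ⟪curl (curl v) x, cross (curl v x) (v x)⟫ =
      ∫ x, ⟪curl v x, curl (fun y => cross (curl v y) (v y)) x⟫ := by
    refine integral_inner_curl_eq_integral_inner_curl_of_integrable hω1 hΨ1 ?_ ?_ ?_
    · -- `(ω × v) × ω` is integrable: `≤ B₀ ‖ω‖²`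
      refine (Iω.const_mul B₀).mono'
        ((crossCLM.continuous₂.comp₂ hΨc hωc).aestronglyMeasurable) (Eventually.of_forall fun x => ?_)
      calc ‖cross (cross (curl v x) (v x)) (curl v x)‖
          ≤ ‖cross (curl v x) (v x)‖ * ‖curl v x‖ := norm_cross_le' _ _
        _ ≤ (‖curl v x‖ * ‖v x‖) * ‖curl v x‖ :=
            mul_le_mul_of_nonneg_right (norm_cross_le' _ _) (norm_nonneg _)
        _ ≤ (‖curl v x‖ * B₀) * ‖curl v x‖ := by gcongr; exact hB₀ x
        _ = B₀ * ‖curl v x‖ ^ 2 := by ring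
    · -- `⟪ω, curl (ω × v)⟫` is integrable: `≤ B₀‖ω‖‖∇ω‖ + B₁‖ω‖²`
      have hcc : Continuous (curl fun y => cross (curl v y) (v y)) := continuous_curl hΨ1
      refine ((Iprod.const_mul B₀).add (Iω.const_mul B₁)).mono'
        ((hωc.inner hcc).aestronglyMeasurable) (Eventually.of_forall fun x => ?_)
      calc ‖⟪curl v x, curl (fun y => cross (curl v y) (v y)) x⟫‖
          ≤ ‖curl v x‖ * ‖curl (fun y => cross (curl v y) (v y)) x‖ := norm_inner_le_norm _ _
        _ ≤ ‖curl v x‖ * (B₀ * ‖fderiv ℝ (curl v) x‖ + B₁ * ‖curl v x‖) :=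
            mul_le_mul_of_nonneg_left (hcurlX x) (norm_nonneg _)
        _ = B₀ * (‖curl v x‖ * ‖fderiv ℝ (curl v) x‖) + B₁ * ‖curl v x‖ ^ 2 := by ring
    · -- `⟪ω × v, curl ω⟫` is integrable: `≤ B₀ κ ‖ω‖‖∇ω‖`
      have hcc : Continuous (curl (curl v)) := continuous_curl hω1
      refine (Iprod.const_mul (B₀ * ‖curlCLM‖)).mono' ((hΨc.inner hcc).aestronglyMeasurable)
        (Eventually.of_forall fun x => ?_)
      calc ‖⟪cross (curl v x) (v x), curl (curl v) x⟫‖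
          ≤ ‖cross (curl v x) (v x)‖ * ‖curl (curl v) x‖ := norm_inner_le_norm _ _
        _ ≤ (‖curl v x‖ * B₀) * (‖curlCLM‖ * ‖fderiv ℝ (curl v) x‖) := by
            refine mul_le_mul ((norm_cross_le' _ _).trans ?_) (hcωle x) (norm_nonneg _) (by positivity)
            exact mul_le_mul_of_nonneg_left (hB₀ x) (norm_nonneg _)
        _ = B₀ * ‖curlCLM‖ * (‖curl v x‖ * ‖fderiv ℝ (curl v) x‖) := by ring
  -- ### assemble
  have IA : Integrable fun x => ⟪curl v x, convect v (curl v) x⟫ := by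
    refine (Iprod.const_mul B₀).mono'
      ((hωc.inner (hDω.clm_apply hvc))).aestronglyMeasurable (Eventually.of_forall fun x => ?_)
    calc ‖⟪curl v x, convect v (curl v) x⟫‖ ≤ ‖curl v x‖ * ‖convect v (curl v) x‖ :=
          norm_inner_le_norm _ _
      _ ≤ ‖curl v x‖ * (‖fderiv ℝ (curl v) x‖ * B₀) := by
          refine mul_le_mul_of_nonneg_left ?_ (norm_nonneg _)
          rw [convect]
          exact (ContinuousLinearMap.le_opNorm _ _).trans
            (mul_le_mul_of_nonneg_left (hB₀ x) (norm_nonneg _))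
      _ = B₀ * (‖curl v x‖ * ‖fderiv ℝ (curl v) x‖) := by ring
  have IB : Integrable fun x => ⟪curl v x, curl (fun y => cross (curl v y) (v y)) x⟫ := by
    have hcc : Continuous (curl fun y => cross (curl v y) (v y)) := continuous_curl hΨ1
    refine ((Iprod.const_mul B₀).add (Iω.const_mul B₁)).mono'
      ((hωc.inner hcc).aestronglyMeasurable) (Eventually.of_forall fun x => ?_)
    calc ‖⟪curl v x, curl (fun y => cross (curl v y) (v y)) x⟫‖
        ≤ ‖curl v x‖ * ‖curl (fun y => cross (curl v y) (v y)) x‖ := norm_inner_le_norm _ _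
      _ ≤ ‖curl v x‖ * (B₀ * ‖fderiv ℝ (curl v) x‖ + B₁ * ‖curl v x‖) :=
          mul_le_mul_of_nonneg_left (hcurlX x) (norm_nonneg _)
      _ = B₀ * (‖curl v x‖ * ‖fderiv ℝ (curl v) x‖) + B₁ * ‖curl v x‖ ^ 2 := by ring
  calc ∫ x, ⟪curl v x, fderiv ℝ v x (curl v x)⟫
      = ∫ x, (⟪curl v x, convect v (curl v) x⟫ -
          ⟪curl v x, curl (fun y => cross (curl v y) (v y)) x⟫) :=
        integral_congr_ae (Eventually.of_forall fun x => by
          simp only; rw [hpt x, inner_sub_right])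
    _ = (∫ x, ⟪curl v x, convect v (curl v) x⟫) -
          ∫ x, ⟪curl v x, curl (fun y => cross (curl v y) (v y)) x⟫ := integral_sub IA IB
    _ = -∫ x, ⟪curl (curl v) x, cross (curl v x) (v x)⟫ := by rw [hA, hB, zero_sub]
    _ = ∫ x, ⟪curl (curl v) x, cross (v x) (curl v x)⟫ := by
        rw [← integral_neg]
        refine integral_congr_ae (Eventually.of_forall fun x => ?_)
        simp only
        rw [cross_swap (curl v x) (v x), inner_neg_right, neg_neg]

/-! ### §4 The fixed-time near-Beltrami stretching estimate -/

/-- **The fixed-time stretching estimate under near-Beltrami depletion coupled to the enstrophy**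
(Farhat–Grujić's estimate of `I₂″`, p. 5, with `ψ ≡ 1`, `S_s = ℝ³`, `M = 0`). Let `v ∈ C²(ℝ³; ℝ³)`
be divergence free, bounded with bounded gradient, `v, ∇v, ∇²v ∈ L²`, `ω = curl v`, and suppose
`|v × ω| ≤ a |v| |ω|` everywhere (`sin∠(v, ω) ≤ a`) with the coupling `a⁴ ∫|∇v|²_F ≤ c⁴`
(i.e. `a ‖∇v‖₂^{1/2} ≤ c`). Then
`2∫⟪ω, (∇v)ω⟫ ≤ ν ∫|∇ω|²_F + (2κ⁴K₀⁶c⁴/ν³) (∫|ω|²)²`, `κ = ‖curl‖`, `K₀` the tree's `H¹ ⊂ L⁶`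
constant. Proof = the printed chain: Lamb form of the stretching
(`integral_stretching_eq_integral_inner_curl_cross`), `|⟪curl ω, v × ω⟫| ≤ a|curl ω||v||ω|`,
Cauchy–Schwarz, Hölder `∫|v|²|ω|² ≤ ‖v‖₆²‖ω‖₃²`, `‖v‖₆ ≤ K₀‖∇v‖₂`, `‖ω‖₃² ≤ ‖ω‖₂‖ω‖₆ ≤ K₀‖ω‖₂‖∇ω‖₂`
(Cauchy–Schwarz twice and Sobolev), Young twice (`stretching_count`), and `∫|∇v|²_F ≤ ∫|ω|²` for
divergence-free `v`. [cite: FarhatGrujic2018, Thm 1 (proof p. 5: estimate of I₂″, "Hölder's inequality w.r.t. y, Sobolev embedding and Ladyzhenskaya's inequality … Young's inequality")] -/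
theorem two_mul_integral_stretching_le_of_nearBeltrami {ν c : ℝ} (hν : 0 < ν)
    {v : EuclideanSpace ℝ (Fin 3) → EuclideanSpace ℝ (Fin 3)} (hv : ContDiff ℝ 2 v)
    (hdiv : VectorCalculus.IsDivFree v) {B₀ : ℝ} (hB₀ : ∀ x, ‖v x‖ ≤ B₀) {B₁ : ℝ}
    (hB₁ : ∀ x, ‖fderiv ℝ v x‖ ≤ B₁) (hE : Integrable fun x => ‖v x‖ ^ 2)
    (hG : Integrable fun x => ‖fderiv ℝ v x‖ ^ 2)
    (hH : Integrable fun x => ‖fderiv ℝ (fderiv ℝ v) x‖ ^ 2) {a : ℝ} (ha : 0 ≤ a)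
    (hang : ∀ x, ‖cross (v x) (curl v x)‖ ≤ a * (‖v x‖ * ‖curl v x‖))
    (hcpl : a ^ 4 * (∫ x, frobeniusNormSq (fderiv ℝ v x)) ≤ c ^ 4) :
    2 * ∫ x, ⟪curl v x, fderiv ℝ v x (curl v x)⟫ ≤
      ν * (∫ x, frobeniusNormSq (fderiv ℝ (curl v) x)) +
        2 * ‖curlCLM‖ ^ 4 *
            (SNormLESNormFDerivOfEqConst (EuclideanSpace ℝ (Fin 3))
              (volume : Measure (EuclideanSpace ℝ (Fin 3))) 2 : ℝ) ^ 6 * c ^ 4 / ν ^ 3 *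
          (∫ x, ‖curl v x‖ ^ 2) * (∫ x, ‖curl v x‖ ^ 2) := by
  set K₀ : ℝ := (SNormLESNormFDerivOfEqConst (EuclideanSpace ℝ (Fin 3))
    (volume : Measure (EuclideanSpace ℝ (Fin 3))) 2 : ℝ) with hK₀
  have hK₀0 : 0 ≤ K₀ := NNReal.coe_nonneg _
  set κ : ℝ := ‖curlCLM‖ with hκ
  have hκ0 : 0 ≤ κ := norm_nonneg _
  -- ### basic objects
  have hv1 : ContDiff ℝ 1 v := hv.of_le (by norm_num)
  have hvc : Continuous v := hv.continuous
  have hDv : Continuous (fderiv ℝ v) := hv.continuous_fderiv (by norm_num)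
  have hω1 : ContDiff ℝ 1 (curl v) := contDiff_curl (n := 1) (by exact hv)
  have hωc : Continuous (curl v) := hω1.continuous
  have hDω : Continuous (fderiv ℝ (curl v)) := hω1.continuous_fderiv one_ne_zero
  have hcωc : Continuous (curl (curl v)) := continuous_curl hω1
  have hB₀0 : 0 ≤ B₀ := (norm_nonneg _).trans (hB₀ 0)
  have hB₁0 : 0 ≤ B₁ := (norm_nonneg _).trans (hB₁ 0)
  have hωle : ∀ x, ‖curl v x‖ ≤ κ * ‖fderiv ℝ v x‖ := fun x => norm_curl_le v x
  have hωbd : ∀ x, ‖curl v x‖ ≤ κ * B₁ := fun x =>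
    (hωle x).trans (mul_le_mul_of_nonneg_left (hB₁ x) hκ0)
  have hDωle : ∀ x, ‖fderiv ℝ (curl v) x‖ ≤ κ * ‖fderiv ℝ (fderiv ℝ v) x‖ := fun x => by
    rw [hκ, fderiv_curl hv]
    exact ContinuousLinearMap.opNorm_comp_le _ _
  have hcωle : ∀ x, ‖curl (curl v) x‖ ≤ κ * ‖fderiv ℝ (curl v) x‖ :=
    fun x => norm_curl_le (curl v) x
  set Bω : ℝ := κ * B₁ with hBω
  have hBω0 : 0 ≤ Bω := mul_nonneg hκ0 hB₁0
  -- ### integrability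
  have Iω : Integrable fun x => ‖curl v x‖ ^ 2 := by
    refine (hG.const_mul (κ ^ 2)).mono' ((hωc.norm.pow 2).aestronglyMeasurable)
      (Eventually.of_forall fun x => ?_)
    rw [Real.norm_of_nonneg (sq_nonneg _), ← mul_pow]
    exact pow_le_pow_left₀ (norm_nonneg _) (hωle x) 2
  have IDω : Integrable fun x => ‖fderiv ℝ (curl v) x‖ ^ 2 := by
    refine (hH.const_mul (κ ^ 2)).mono' ((hDω.norm.pow 2).aestronglyMeasurable)
      (Eventually.of_forall fun x => ?_)
    rw [Real.norm_of_nonneg (sq_nonneg _), ← mul_pow]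
    exact pow_le_pow_left₀ (norm_nonneg _) (hDωle x) 2
  have Icω : Integrable fun x => ‖curl (curl v) x‖ ^ 2 := by
    refine (IDω.const_mul (κ ^ 2)).mono' ((hcωc.norm.pow 2).aestronglyMeasurable)
      (Eventually.of_forall fun x => ?_)
    rw [Real.norm_of_nonneg (sq_nonneg _), ← mul_pow]
    exact pow_le_pow_left₀ (norm_nonneg _) (hcωle x) 2
  have Ifv : Integrable fun x => frobeniusNormSq (fderiv ℝ v x) := by
    refine (hG.const_mul 3).mono' (continuous_frobeniusNormSq_fderiv hv (by norm_num)).aestronglyMeasurable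
      (Eventually.of_forall fun x => ?_)
    rw [Real.norm_of_nonneg (frobeniusNormSq_nonneg _)]
    exact frobeniusNormSq_le_three_mul _
  have Ifω : Integrable fun x => frobeniusNormSq (fderiv ℝ (curl v) x) := by
    refine (IDω.const_mul 3).mono' (continuous_frobeniusNormSq_fderiv hω1 one_ne_zero).aestronglyMeasurable
      (Eventually.of_forall fun x => ?_)
    rw [Real.norm_of_nonneg (frobeniusNormSq_nonneg _)]
    exact frobeniusNormSq_le_three_mul _
  have hω2 : MemLp (curl v) 2 volume := (memLp_two_iff_integrable_sq_norm hωc.aestronglyMeasurable).2 Iω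
  have hDω2 : MemLp (fun x => fderiv ℝ (curl v) x) 2 volume :=
    (memLp_two_iff_integrable_sq_norm hDω.aestronglyMeasurable).2 IDω
  have hcω2 : MemLp (curl (curl v)) 2 volume :=
    (memLp_two_iff_integrable_sq_norm hcωc.aestronglyMeasurable).2 Icω
  -- powers of `|ω|` and `|v|` (bounded fields with square-integrable norm)
  have hpow : ∀ {w : EuclideanSpace ℝ (Fin 3) → EuclideanSpace ℝ (Fin 3)} {B : ℝ} (_ : Continuous w)
      (_ : ∀ x, ‖w x‖ ≤ B) (_ : Integrable fun x => ‖w x‖ ^ 2) (k : ℕ),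
      Integrable fun x => ‖w x‖ ^ (k + 2) := by
    intro w B hwc hwB hw2 k
    have hB : 0 ≤ B := (norm_nonneg _).trans (hwB 0)
    refine (hw2.const_mul (B ^ k)).mono' ((hwc.norm.pow _).aestronglyMeasurable)
      (Eventually.of_forall fun x => ?_)
    rw [Real.norm_of_nonneg (by positivity), pow_add]
    exact mul_le_mul_of_nonneg_right (pow_le_pow_left₀ (norm_nonneg _) (hwB x) k) (sq_nonneg _)
  have Iv6 : Integrable fun x => ‖v x‖ ^ 6 := hpow hvc hB₀ hE 4
  have Iω3 : Integrable fun x => ‖curl v x‖ ^ 3 := hpow hωc hωbd Iω 1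
  have Iω4 : Integrable fun x => ‖curl v x‖ ^ 4 := hpow hωc hωbd Iω 2
  have Iω6 : Integrable fun x => ‖curl v x‖ ^ 6 := hpow hωc hωbd Iω 4
  -- ### the quantities
  set Y : ℝ := ∫ x, ‖curl v x‖ ^ 2 with hY
  set D : ℝ := ∫ x, frobeniusNormSq (fderiv ℝ (curl v) x) with hD
  set F : ℝ := ∫ x, frobeniusNormSq (fderiv ℝ v x) with hF
  set Dop : ℝ := ∫ x, ‖fderiv ℝ (curl v) x‖ ^ 2 with hDop
  set Gop : ℝ := ∫ x, ‖fderiv ℝ v x‖ ^ 2 with hGop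
  set Dc : ℝ := ∫ x, ‖curl (curl v) x‖ ^ 2 with hDc
  have hY0 : 0 ≤ Y := integral_nonneg fun x => sq_nonneg _
  have hD0 : 0 ≤ D := integral_nonneg fun x => frobeniusNormSq_nonneg _
  have hF0 : 0 ≤ F := integral_nonneg fun x => frobeniusNormSq_nonneg _
  have hDop0 : 0 ≤ Dop := integral_nonneg fun x => sq_nonneg _
  have hGop0 : 0 ≤ Gop := integral_nonneg fun x => sq_nonneg _
  have hDc0 : 0 ≤ Dc := integral_nonneg fun x => sq_nonneg _
  have hGle : Gop ≤ F := integral_mono hG Ifv fun x => sq_opNorm_le_frobeniusNormSq _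
  have hDopD : Dop ≤ D := integral_mono IDω Ifω fun x => sq_opNorm_le_frobeniusNormSq _
  have hDcle : Dc ≤ κ ^ 2 * Dop := by
    rw [hDop, ← integral_const_mul]
    refine integral_mono Icω (IDω.const_mul _) fun x => ?_
    simp only
    rw [← mul_pow]
    exact pow_le_pow_left₀ (norm_nonneg _) (hcωle x) 2
  set sY := Real.sqrt Y with hsY
  set sD := Real.sqrt D with hsD
  have hsY0 : 0 ≤ sY := Real.sqrt_nonneg _
  have hsD0 : 0 ≤ sD := Real.sqrt_nonneg _
  have hsY2 : sY ^ 2 = Y := Real.sq_sqrt hY0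
  have hsD2 : sD ^ 2 = D := Real.sq_sqrt hD0
  -- `F ≤ Y` (`∫|∇v|²_F ≤ ∫|ω|²` for divergence-free `v`)
  have hFY : F ≤ Y := by
    have hl := lintegral_frobeniusNormSq_fderiv_le_lintegral_sq_norm_curl hv hdiv
      (lintegral_enorm_sq_lt_top_of_integrable_sq hE)
    have e1 : ∫⁻ x, ENNReal.ofReal (frobeniusNormSq (fderiv ℝ v x)) = ENNReal.ofReal F := by
      rw [hF, ofReal_integral_eq_lintegral_ofReal Ifv
        (Eventually.of_forall fun x => frobeniusNormSq_nonneg _)]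
    have e2 : ∫⁻ x, ‖curl v x‖ₑ ^ 2 = ENNReal.ofReal Y := by
      rw [hY, ofReal_integral_eq_lintegral_ofReal Iω (Eventually.of_forall fun x => sq_nonneg _)]
      exact lintegral_congr fun x => by rw [← ofReal_norm, ENNReal.ofReal_pow (norm_nonneg _)]
    rw [e1, e2] at hl
    exact (ENNReal.ofReal_le_ofReal_iff hY0).1 hl
  -- ### Step 1–2: Lamb form and Cauchy–Schwarz, `2S ≤ 2a √Dc √M`
  set g : EuclideanSpace ℝ (Fin 3) → ℝ := fun x => ‖v x‖ * ‖curl v x‖ with hg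
  have hgc : Continuous g := hvc.norm.mul hωc.norm
  have hg0 : ∀ x, 0 ≤ g x := fun x => mul_nonneg (norm_nonneg _) (norm_nonneg _)
  have hgn : ∀ x, ‖g x‖ = g x := fun x => Real.norm_of_nonneg (hg0 x)
  set M : ℝ := ∫ x, ‖g x‖ ^ 2 with hM
  have hM0 : 0 ≤ M := integral_nonneg fun x => sq_nonneg _
  have Ig2 : Integrable fun x => ‖g x‖ ^ 2 := by
    refine (Iω.const_mul (B₀ ^ 2)).mono' ((hgc.norm.pow 2).aestronglyMeasurable)
      (Eventually.of_forall fun x => ?_)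
    rw [Real.norm_of_nonneg (sq_nonneg _), hgn, hg]; simp only
    rw [mul_pow]
    exact mul_le_mul_of_nonneg_right (pow_le_pow_left₀ (norm_nonneg _) (hB₀ x) 2) (sq_nonneg _)
  have Iprod2 : Integrable fun x => ‖curl (curl v) x‖ * ‖g x‖ := hcω2.norm.integrable_mul
    ((memLp_two_iff_integrable_sq_norm hgc.aestronglyMeasurable).2 Ig2).norm
  have hS : 2 * ∫ x, ⟪curl v x, fderiv ℝ v x (curl v x)⟫ ≤ 2 * a * (κ * sD) * Real.sqrt M := by
    rw [integral_stretching_eq_integral_inner_curl_cross hv hdiv hB₀ hB₁ hG hH]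
    have h1' : ∫ x, ⟪curl (curl v) x, cross (v x) (curl v x)⟫ ≤
        ∫ x, a * (‖curl (curl v) x‖ * ‖g x‖) := by
      have IL : Integrable fun x => ⟪curl (curl v) x, cross (v x) (curl v x)⟫ := by
        refine (Iprod2.const_mul 1).mono' ((hcωc.inner (crossCLM.continuous₂.comp₂ hvc hωc))
          |>.aestronglyMeasurable) (Eventually.of_forall fun x => ?_)
        rw [one_mul]
        calc ‖⟪curl (curl v) x, cross (v x) (curl v x)⟫‖
            ≤ ‖curl (curl v) x‖ * ‖cross (v x) (curl v x)‖ := norm_inner_le_norm _ _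
          _ ≤ ‖curl (curl v) x‖ * ‖g x‖ := by
              rw [hgn]; exact mul_le_mul_of_nonneg_left (norm_cross_le' _ _) (norm_nonneg _)
      refine integral_mono IL (Iprod2.const_mul a) fun x => ?_
      calc ⟪curl (curl v) x, cross (v x) (curl v x)⟫
          ≤ ‖curl (curl v) x‖ * ‖cross (v x) (curl v x)‖ := real_inner_le_norm _ _
        _ ≤ ‖curl (curl v) x‖ * (a * g x) := mul_le_mul_of_nonneg_left (hang x) (norm_nonneg _)
        _ = a * (‖curl (curl v) x‖ * ‖g x‖) := by rw [hgn]; ring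
    have h2 : ∫ x, ‖curl (curl v) x‖ * ‖g x‖ ≤ Real.sqrt Dc * Real.sqrt M :=
      integral_norm_mul_norm_le_sqrt hcωc hgc Icω Ig2
    have h3 : Real.sqrt Dc ≤ κ * sD := by
      calc Real.sqrt Dc ≤ Real.sqrt (κ ^ 2 * Dop) := Real.sqrt_le_sqrt hDcle
        _ = κ * Real.sqrt Dop := by rw [Real.sqrt_mul (sq_nonneg _), Real.sqrt_sq hκ0]
        _ ≤ κ * sD := mul_le_mul_of_nonneg_left (Real.sqrt_le_sqrt hDopD) hκ0
    rw [integral_const_mul] at h1'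
    calc 2 * ∫ x, ⟪curl (curl v) x, cross (v x) (curl v x)⟫
        ≤ 2 * (a * (Real.sqrt Dc * Real.sqrt M)) := by
          refine mul_le_mul_of_nonneg_left (h1'.trans ?_) (by norm_num)
          exact mul_le_mul_of_nonneg_left h2 ha
      _ ≤ 2 * (a * ((κ * sD) * Real.sqrt M)) := by gcongr
      _ = 2 * a * (κ * sD) * Real.sqrt M := by ring
  -- ### Step 3: Hölder `M = ∫|v|²|ω|² ≤ (∫|v|⁶)^{1/3} (∫|ω|³)^{2/3}`
  set V6 : ℝ := ∫ x, ‖v x‖ ^ 6 with hV6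
  set Z3 : ℝ := ∫ x, ‖curl v x‖ ^ 3 with hZ3
  set Q4 : ℝ := ∫ x, ‖curl v x‖ ^ 4 with hQ4
  set W6 : ℝ := ∫ x, ‖curl v x‖ ^ 6 with hW6
  have hV60 : 0 ≤ V6 := integral_nonneg fun x => by positivity
  have hZ30 : 0 ≤ Z3 := integral_nonneg fun x => by positivity
  have hQ40 : 0 ≤ Q4 := integral_nonneg fun x => by positivity
  have hW60 : 0 ≤ W6 := integral_nonneg fun x => by positivity
  have hMeq : M = ∫ x, ‖v x‖ ^ 2 * ‖curl v x‖ ^ 2 :=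
    integral_congr_ae (Eventually.of_forall fun x => by
      simp only
      rw [hgn, hg]; simp only
      rw [mul_pow])
  have hpq : (3 : ℝ).HolderConjugate (3 / 2) := by
    rw [Real.holderConjugate_iff]; norm_num
  have hf3 : MemLp (fun x => ‖v x‖ ^ 2) (ENNReal.ofReal 3) volume := by
    refine (integrable_norm_rpow_iff (f := fun x => ‖v x‖ ^ 2)
      ((hvc.norm.pow 2).aestronglyMeasurable) (by simp) ENNReal.ofReal_ne_top).1 ?_
    refine Iv6.congr (Eventually.of_forall fun x => ?_)
    simp only
    rw [ENNReal.toReal_ofReal (by norm_num), Real.norm_of_nonneg (sq_nonneg _),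
      show (3 : ℝ) = ((3 : ℕ) : ℝ) by norm_num, Real.rpow_natCast]
    ring
  have hg32 : MemLp (fun x => ‖curl v x‖ ^ 2) (ENNReal.ofReal (3 / 2)) volume := by
    refine (integrable_norm_rpow_iff (f := fun x => ‖curl v x‖ ^ 2)
      ((hωc.norm.pow 2).aestronglyMeasurable) (by simp) ENNReal.ofReal_ne_top).1 ?_
    refine Iω3.congr (Eventually.of_forall fun x => ?_)
    simp only
    rw [ENNReal.toReal_ofReal (by norm_num), Real.norm_of_nonneg (sq_nonneg _),
      ← Real.rpow_natCast ‖curl v x‖ 2, ← Real.rpow_mul (norm_nonneg _),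
      show ((2 : ℕ) : ℝ) * (3 / 2) = ((3 : ℕ) : ℝ) by norm_num, Real.rpow_natCast]
  have hHol := integral_mul_le_Lp_mul_Lq_of_nonneg hpq
    (Eventually.of_forall fun x => sq_nonneg ‖v x‖)
    (Eventually.of_forall fun x => sq_nonneg ‖curl v x‖) hf3 hg32
  have eV : ∫ x, (‖v x‖ ^ 2) ^ (3 : ℝ) = V6 :=
    integral_congr_ae (Eventually.of_forall fun x => by
      simp only
      rw [show (3 : ℝ) = ((3 : ℕ) : ℝ) by norm_num, Real.rpow_natCast]
      ring)
  have eZ : ∫ x, (‖curl v x‖ ^ 2) ^ ((3 : ℝ) / 2) = Z3 :=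
    integral_congr_ae (Eventually.of_forall fun x => by
      simp only
      rw [← Real.rpow_natCast ‖curl v x‖ 2, ← Real.rpow_mul (norm_nonneg _),
        show ((2 : ℕ) : ℝ) * (3 / 2) = ((3 : ℕ) : ℝ) by norm_num, Real.rpow_natCast])
  rw [eV, eZ, ← hMeq] at hHol
  -- ### Step 4: Sobolev for `v`: `V6^{1/3} ≤ K₀² F`
  have hcube : ∀ y : ℝ, 0 ≤ y → (y ^ 3) ^ ((1 : ℝ) / 3) = y := fun y hy => by
    rw [← Real.rpow_natCast, ← Real.rpow_mul hy]; norm_num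
  have hV6le : V6 ≤ (K₀ * Real.sqrt Gop) ^ 6 := integral_norm_pow_six_le hv1 hE hG Iv6
  have hV13 : V6 ^ ((1 : ℝ) / 3) ≤ K₀ ^ 2 * F := by
    have h1 : V6 ≤ ((K₀ * Real.sqrt F) ^ 2) ^ 3 := by
      calc V6 ≤ (K₀ * Real.sqrt Gop) ^ 6 := hV6le
        _ ≤ (K₀ * Real.sqrt F) ^ 6 :=
            pow_le_pow_left₀ (by positivity)
              (mul_le_mul_of_nonneg_left (Real.sqrt_le_sqrt hGle) hK₀0) 6
        _ = ((K₀ * Real.sqrt F) ^ 2) ^ 3 := by rw [← pow_mul]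
    calc V6 ^ ((1 : ℝ) / 3) ≤ (((K₀ * Real.sqrt F) ^ 2) ^ 3) ^ ((1 : ℝ) / 3) :=
          Real.rpow_le_rpow hV60 h1 (by norm_num)
      _ = (K₀ * Real.sqrt F) ^ 2 := hcube _ (sq_nonneg _)
      _ = K₀ ^ 2 * F := by rw [mul_pow, Real.sq_sqrt hF0]
  -- ### Step 5: Cauchy–Schwarz twice and Sobolev for `ω`: `Z3^{2/3} ≤ K₀ √Y √D`
  have hW6le : W6 ≤ (K₀ * Real.sqrt Dop) ^ 6 := integral_norm_pow_six_le hω1 Iω IDω Iω6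
  have hZ3le : Z3 ≤ sY * Real.sqrt Q4 := by
    have hg2c : Continuous fun x => ‖curl v x‖ ^ 2 := hωc.norm.pow 2
    have I : Integrable fun x => ‖(‖curl v x‖ ^ 2)‖ ^ 2 := by
      refine Iω4.congr (Eventually.of_forall fun x => ?_)
      simp only
      rw [Real.norm_of_nonneg (sq_nonneg _), ← pow_mul]
    have h := integral_norm_mul_norm_le_sqrt hωc hg2c Iω I
    have e1 : ∫ x, ‖curl v x‖ * ‖(‖curl v x‖ ^ 2)‖ = Z3 :=
      integral_congr_ae (Eventually.of_forall fun x => by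
        simp only
        rw [Real.norm_of_nonneg (sq_nonneg _)]; ring)
    have e2 : ∫ x, ‖(‖curl v x‖ ^ 2)‖ ^ 2 = Q4 :=
      integral_congr_ae (Eventually.of_forall fun x => by
        simp only
        rw [Real.norm_of_nonneg (sq_nonneg _), ← pow_mul])
    rw [e1, e2] at h
    exact h
  have hQ4le : Q4 ≤ sY * Real.sqrt W6 := by
    have hg3c : Continuous fun x => ‖curl v x‖ ^ 3 := hωc.norm.pow 3
    have I : Integrable fun x => ‖(‖curl v x‖ ^ 3)‖ ^ 2 := by
      refine Iω6.congr (Eventually.of_forall fun x => ?_)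
      simp only
      rw [Real.norm_of_nonneg (by positivity), ← pow_mul]
    have h := integral_norm_mul_norm_le_sqrt hωc hg3c Iω I
    have e1 : ∫ x, ‖curl v x‖ * ‖(‖curl v x‖ ^ 3)‖ = Q4 :=
      integral_congr_ae (Eventually.of_forall fun x => by
        simp only
        rw [Real.norm_of_nonneg (by positivity)]; ring)
    have e2 : ∫ x, ‖(‖curl v x‖ ^ 3)‖ ^ 2 = W6 :=
      integral_congr_ae (Eventually.of_forall fun x => by
        simp only
        rw [Real.norm_of_nonneg (by positivity), ← pow_mul])
    rw [e1, e2] at h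
    exact h
  have hn : Z3 ^ 2 ≤ (K₀ * sY * sD) ^ 3 := by
    have hsW : Real.sqrt W6 ≤ (K₀ * sD) ^ 3 := by
      calc Real.sqrt W6 ≤ Real.sqrt ((K₀ * Real.sqrt Dop) ^ 6) := Real.sqrt_le_sqrt hW6le
        _ = (K₀ * Real.sqrt Dop) ^ 3 := by
            rw [show (K₀ * Real.sqrt Dop) ^ 6 = ((K₀ * Real.sqrt Dop) ^ 3) ^ 2 by ring,
              Real.sqrt_sq (by positivity)]
        _ ≤ (K₀ * sD) ^ 3 :=
            pow_le_pow_left₀ (by positivity)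
              (mul_le_mul_of_nonneg_left (Real.sqrt_le_sqrt hDopD) hK₀0) 3
    have hQ : Q4 ≤ sY * (K₀ * sD) ^ 3 := hQ4le.trans (mul_le_mul_of_nonneg_left hsW hsY0)
    calc Z3 ^ 2 ≤ (sY * Real.sqrt Q4) ^ 2 := pow_le_pow_left₀ hZ30 hZ3le 2
      _ = Y * Q4 := by rw [mul_pow, hsY2, Real.sq_sqrt hQ40]
      _ ≤ Y * (sY * (K₀ * sD) ^ 3) := mul_le_mul_of_nonneg_left hQ hY0
      _ = (K₀ * sY * sD) ^ 3 := by rw [← hsY2]; ring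
  have hZ23 : Z3 ^ ((1 : ℝ) / (3 / 2)) ≤ K₀ * sY * sD := by
    have e : (1 : ℝ) / (3 / 2) = 2 * ((1 : ℝ) / 3) := by norm_num
    rw [e, Real.rpow_mul hZ30, Real.rpow_two]
    calc (Z3 ^ 2) ^ ((1 : ℝ) / 3) ≤ ((K₀ * sY * sD) ^ 3) ^ ((1 : ℝ) / 3) :=
          Real.rpow_le_rpow (sq_nonneg _) hn (by norm_num)
      _ = K₀ * sY * sD := hcube _ (by positivity)
  -- ### Step 6: `M ≤ K₀³ F √Y √D`
  have hMle : M ≤ K₀ ^ 3 * F * sY * sD := by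
    calc M ≤ V6 ^ ((1 : ℝ) / 3) * Z3 ^ ((1 : ℝ) / (3 / 2)) := hHol
      _ ≤ (K₀ ^ 2 * F) * (K₀ * sY * sD) :=
          mul_le_mul hV13 hZ23 (Real.rpow_nonneg hZ30 _) (by positivity)
      _ = K₀ ^ 3 * F * sY * sD := by ring
  -- ### Step 7: the count
  exact stretching_count hν hκ0 hK₀0 ha hY0 hD0 hF0 hS hMle hcpl hFY

set_option maxHeartbeats 400000 in -- buildfix (bf3-g25): 160k/180k FAIL, 200k PASS at accept time; line-neutral budget line
/-- **The fixed-time estimate in the shape of the tree's slab Grönwall**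
(`integral_sq_norm_curl_le_of_direction_slab`, constants `C₁ = C₃ = C₄ = 0`): for `ν > 0` and
`c ≥ 0` there is `C₂ ≥ 0` (namely `2κ⁴K₀⁶c⁴/ν³`) such that every divergence-free `C²` field as
in `two_mul_integral_stretching_le_of_nearBeltrami` satisfies
`2∫⟪ω, (∇v)ω⟫ ≤ ν∫|∇ω|²_F + (0 + C₂∫|ω|² + 0·∫|v|²)∫|ω|² + 0·∫|∇v|²_F`.
[cite: FarhatGrujic2018, Thm 1 (proof p. 5, estimate of I₂″)] -/
theorem exists_two_mul_integral_stretching_le_of_nearBeltrami {ν : ℝ} (c : ℝ) (hν : 0 < ν) :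
    ∃ C₂ : ℝ, 0 ≤ C₂ ∧
      ∀ ⦃v : EuclideanSpace ℝ (Fin 3) → EuclideanSpace ℝ (Fin 3)⦄ (_ : ContDiff ℝ 2 v)
        (_ : VectorCalculus.IsDivFree v) ⦃B₀ : ℝ⦄ (_ : ∀ x, ‖v x‖ ≤ B₀) ⦃B₁ : ℝ⦄
        (_ : ∀ x, ‖fderiv ℝ v x‖ ≤ B₁) (_ : Integrable fun x => ‖v x‖ ^ 2)
        (_ : Integrable fun x => ‖fderiv ℝ v x‖ ^ 2)
        (_ : Integrable fun x => ‖fderiv ℝ (fderiv ℝ v) x‖ ^ 2) ⦃a : ℝ⦄ (_ : 0 ≤ a)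
        (_ : ∀ x, ‖cross (v x) (curl v x)‖ ≤ a * (‖v x‖ * ‖curl v x‖))
        (_ : a ^ 4 * (∫ x, frobeniusNormSq (fderiv ℝ v x)) ≤ c ^ 4),
        2 * ∫ x, ⟪curl v x, fderiv ℝ v x (curl v x)⟫ ≤
          ν * (∫ x, frobeniusNormSq (fderiv ℝ (curl v) x)) +
            (0 + C₂ * (∫ x, ‖curl v x‖ ^ 2) + 0 * (∫ x, ‖v x‖ ^ 2)) * (∫ x, ‖curl v x‖ ^ 2) +
            0 * (∫ x, frobeniusNormSq (fderiv ℝ v x)) := by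
  refine ⟨2 * ‖curlCLM‖ ^ 4 *
      (SNormLESNormFDerivOfEqConst (EuclideanSpace ℝ (Fin 3))
        (volume : Measure (EuclideanSpace ℝ (Fin 3))) 2 : ℝ) ^ 6 * c ^ 4 / ν ^ 3,
    by positivity, ?_⟩
  intro v hv hdiv B₀ hB₀ B₁ hB₁ hE hG hH a ha hang hcpl
  have h := two_mul_integral_stretching_le_of_nearBeltrami hν hv hdiv hB₀ hB₁ hE hG hH ha hang hcpl
  simpa only [zero_add, zero_mul, add_zero, mul_assoc] using h

end FarhatGrujic2018

/-! ### §5 The criterion along classical solutions -/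

open FarhatGrujic2018 in
/-- **The a priori `H¹` bound under near-Beltrami depletion coupled to the enstrophy** (the
global `r = ∞` content of Farhat–Grujić's Theorem 1: "the localized enstrophy remains bounded").
Let `ν > 0`, `T > 0`, `(u, p)` a classical unforced Navier–Stokes solution on `ℝ³ × [0, T)` with all
`L²` Sobolev seminorms bounded on every `[0, T'']`, `T'' < T`. If there are a function `a ≥ 0` and a
constant `c ≥ 0` with `|u × ω|(x,t) ≤ a(t)|u(x,t)||ω(x,t)|` for all `x` (`sin θ ≤ a(t)`) and
`a(t) ‖∇u(t)‖₂^{1/2} ≤ c` for all `t ∈ [0, T)` (`‖∇u(t)‖₂² = ∫|∇u(t)|²_F`), then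
`‖u(t)‖²₂ + ‖∇u(t)‖²₂` is bounded on `[0, T)`. Proof: verbatim the architecture of the tree's
`exists_uniform_H1_bound_of_holderHalf_direction` — Tao's energy class, the fixed-time estimate
`exists_two_mul_integral_stretching_le_of_nearBeltrami` (with the slab's sup bounds on `u` and
`∇u`), the slab Grönwall `integral_sq_norm_curl_le_of_direction_slab`, and `∫|∇u|² ≤ ∫|ω|²`.
[cite: FarhatGrujic2018, Thm 1 (conclusion "the localized enstrophy remains bounded", global special case r = ∞); Tao2011, Lemma 8.1] -/
theorem exists_uniform_H1_bound_of_nearBeltrami {ν T c : ℝ} (hν : 0 < ν) (hT : 0 < T)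
    {u : ℝ → (EuclideanSpace ℝ (Fin 3)) → (EuclideanSpace ℝ (Fin 3))}
    {p : ℝ → (EuclideanSpace ℝ (Fin 3)) → ℝ}
    (hsol : IsClassicalNSSolutionOn (Ico 0 T) ν 0 u p)
    (hreg : ∀ T'' < T, HasBoundedSobolevNormsOn (Icc 0 T'') u) {a : ℝ → ℝ}
    (ha : ∀ t ∈ Ico 0 T, 0 ≤ a t)
    (hang : ∀ t ∈ Ico 0 T, ∀ x, ‖cross (u t x) (curl (u t) x)‖ ≤ a t * (‖u t x‖ * ‖curl (u t) x‖))
    (hcpl : ∀ t ∈ Ico 0 T,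
      a t * Real.sqrt (Real.sqrt (∫ x, frobeniusNormSq (fderiv ℝ (u t) x))) ≤ c) :
    ∃ A : ℝ, 0 ≤ A ∧ ∀ t ∈ Ico 0 T,
      (∫⁻ x, ‖u t x‖ₑ ^ 2) + (∫⁻ x, ENNReal.ofReal (frobeniusNormSq (fderiv ℝ (u t) x))) ≤
        ENNReal.ofReal A := by
  obtain ⟨C, hCtop, hTao⟩ := tao_finite_energy_smooth_energy_bound_holds
  obtain ⟨C₂, hC₂, hstr⟩ := exists_two_mul_integral_stretching_le_of_nearBeltrami c hν
  -- the initial energy and enstrophy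
  have hreg0 : HasBoundedSobolevNormsOn (Icc 0 (T / 2)) u := hreg (T / 2) (by linarith)
  have h00 : (0 : ℝ) ∈ Icc 0 (T / 2) := ⟨le_rfl, by linarith⟩
  set E₀ : ℝ≥0∞ := ∫⁻ x, ‖u 0 x‖ₑ ^ 2 with hE₀
  have hE₀top : E₀ < ⊤ := by
    obtain ⟨C0, hC0⟩ := hreg0 0
    refine lt_of_le_of_lt (le_of_eq (lintegral_congr fun x => ?_)) ((hC0 0 h00).trans_lt ENNReal.coe_lt_top)
    rw [← ofReal_norm, ← ofReal_norm, norm_iteratedFDeriv_zero]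
  have hCE : C * E₀ < ⊤ := ENNReal.mul_lt_top hCtop hE₀top
  set Ē : ℝ := (C * E₀).toReal with hĒ
  have hĒ0 : 0 ≤ Ē := ENNReal.toReal_nonneg
  set I : ℝ := (C * E₀ / ENNReal.ofReal ν).toReal with hIdef
  have hI0 : 0 ≤ I := ENNReal.toReal_nonneg
  set Y₀ : ℝ := ∫ x, ‖curl (u 0) x‖ ^ 2 with hY₀
  have hY₀0 : 0 ≤ Y₀ := integral_nonneg fun x => sq_nonneg _
  set Ystar : ℝ := (Y₀ + 0 * I) * Real.exp ((0 + 0 * Ē) * T + C₂ * (‖curlCLM‖ ^ 2 * I)) with hYstar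
  have hYstar0 : 0 ≤ Ystar := by positivity
  refine ⟨Ē + Ystar, by positivity, ?_⟩
  intro t ht
  -- a closed slab containing `t`
  set T'' : ℝ := (t + T) / 2 with hT''def
  have htT'' : t < T'' := by rw [hT''def]; linarith [ht.2]
  have hT''T : T'' < T := by rw [hT''def]; linarith [ht.2]
  have hT''pos : 0 < T'' := lt_of_le_of_lt ht.1 htT''
  have hS : IsClassicalNSSolutionOn (Icc 0 T'') ν 0 u p :=
    hsol.mono (Icc_subset_Ico_right hT''T) (uniqueDiffOn_Icc hT''pos)
  have hB : HasBoundedSobolevNormsOn (Icc 0 T'') u := hreg T'' hT''T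
  have htS : t ∈ Icc 0 T'' := ⟨ht.1, htT''.le⟩
  -- Tao's energy class on the slab
  have hfe : ∃ A : ℝ≥0∞, A < ⊤ ∧ ∀ s ∈ Icc 0 T'', ∫⁻ x, ‖u s x‖ₑ ^ 2 ≤ A := by
    obtain ⟨C0, hC0⟩ := hB 0
    refine ⟨C0, ENNReal.coe_lt_top, fun s hs => ?_⟩
    refine le_trans (le_of_eq (lintegral_congr fun x => ?_)) (hC0 s hs)
    rw [← ofReal_norm, ← ofReal_norm, norm_iteratedFDeriv_zero]
  obtain ⟨hen, hdiss⟩ := hTao ν T'' hν hT''pos u p hS hfe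
  have hen' : ∀ s ∈ Icc 0 T'', ∫⁻ x, ‖u s x‖ₑ ^ 2 ≤ ENNReal.ofReal Ē := fun s hs => by
    rw [hĒ, ENNReal.ofReal_toReal hCE.ne]
    exact hen s hs
  have hdiss' : ∫⁻ s in Ioo 0 T'', ∫⁻ x, ENNReal.ofReal (frobeniusNormSq (fderiv ℝ (u s) x)) ≤
      ENNReal.ofReal I := by
    have hν' : ENNReal.ofReal ν ≠ 0 := (ENNReal.ofReal_pos.2 hν).ne'
    have h1 : ∫⁻ s in Ioo 0 T'', ∫⁻ x, ENNReal.ofReal (frobeniusNormSq (fderiv ℝ (u s) x)) ≤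
        C * E₀ / ENNReal.ofReal ν := by
      rw [ENNReal.le_div_iff_mul_le (Or.inl hν') (Or.inl ENNReal.ofReal_ne_top), mul_comm]
      exact hdiss
    refine h1.trans (le_of_eq ?_)
    rw [hIdef, ENNReal.ofReal_toReal]
    exact (ENNReal.div_lt_top hCE.ne hν').ne
  -- sup bounds on the slab (velocity and gradient)
  obtain ⟨B₀, hB₀⟩ := linfty_bound_of_hasBoundedSobolevNormsOn_holds
    (fun r hr => (hS.contDiff_velocity hr).of_le (by norm_cast)) hB
  obtain ⟨B₁, -, hB₁⟩ := exists_forall_norm_fderiv_le_of_hasBoundedSobolevNormsOn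
    (fun r hr => (hS.contDiff_velocity hr).of_le (by norm_cast)) hB
  -- the enstrophy bound on the slab
  have hstrS : ∀ s ∈ Icc 0 T'',
      2 * ∫ x, ⟪curl (u s) x, fderiv ℝ (u s) x (curl (u s) x)⟫ ≤
        ν * (∫ x, frobeniusNormSq (fderiv ℝ (curl (u s)) x)) +
          (0 + C₂ * (∫ x, ‖curl (u s) x‖ ^ 2) + 0 * (∫ x, ‖u s x‖ ^ 2)) *
            (∫ x, ‖curl (u s) x‖ ^ 2) +
          0 * (∫ x, frobeniusNormSq (fderiv ℝ (u s) x)) := by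
    intro s hs
    have hsT : s ∈ Ico 0 T := ⟨hs.1, hs.2.trans_lt hT''T⟩
    have hv : ContDiff ℝ ∞ (u s) := hS.contDiff_velocity hs
    have hv4 : ContDiff ℝ 4 (u s) := hv.of_le (by norm_cast)
    have hv2 : ContDiff ℝ 2 (u s) := hv.of_le (by norm_cast)
    have hfin : ∀ n, ∫⁻ x, ‖iteratedFDeriv ℝ n (u s) x‖ₑ ^ 2 < ⊤ := fun n => by
      obtain ⟨Cn, hCn⟩ := hB n
      exact (hCn s hs).trans_lt ENNReal.coe_lt_top
    have i0 : Integrable fun x => ‖u s x‖ ^ 2 :=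
      integrable_sq_norm_of_lintegral_lt_top hv.continuous ((hen' s hs).trans_lt ENNReal.ofReal_lt_top)
    have i1 : Integrable fun x => ‖fderiv ℝ (u s) x‖ ^ 2 := by
      have h := integrable_sq_norm_of_lintegral_lt_top (hv4.continuous_iteratedFDeriv (by norm_num)) (hfin 1)
      exact h.congr (Eventually.of_forall fun x => by simp only [norm_iteratedFDeriv_one])
    have i2 : Integrable fun x => ‖fderiv ℝ (fderiv ℝ (u s)) x‖ ^ 2 := by
      have h := integrable_sq_norm_of_lintegral_lt_top (hv4.continuous_iteratedFDeriv (by norm_num)) (hfin 2)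
      refine h.congr (Eventually.of_forall fun x => ?_)
      show ‖iteratedFDeriv ℝ 2 (u s) x‖ ^ 2 = ‖fderiv ℝ (fderiv ℝ (u s)) x‖ ^ 2
      rw [← norm_iteratedFDeriv_fderiv, norm_iteratedFDeriv_one]
    -- the coupling `a⁴ F ≤ c⁴` from `a F^{1/4} ≤ c`
    have hF0 : 0 ≤ ∫ x, frobeniusNormSq (fderiv ℝ (u s) x) :=
      integral_nonneg fun x => frobeniusNormSq_nonneg _
    have hcpl' : a s ^ 4 * (∫ x, frobeniusNormSq (fderiv ℝ (u s) x)) ≤ c ^ 4 := by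
      have h4 : (a s * Real.sqrt (Real.sqrt (∫ x, frobeniusNormSq (fderiv ℝ (u s) x)))) ^ 4 =
          a s ^ 4 * ∫ x, frobeniusNormSq (fderiv ℝ (u s) x) := by
        rw [mul_pow, show (4 : ℕ) = 2 * 2 from rfl, pow_mul (Real.sqrt _),
          Real.sq_sqrt (Real.sqrt_nonneg _), Real.sq_sqrt hF0]
      rw [← h4]
      exact pow_le_pow_left₀ (mul_nonneg (ha s hsT) (Real.sqrt_nonneg _)) (hcpl s hsT) 4
    exact hstr hv2 (hS.divFree s hs) (hB₀ s hs) (hB₁ s hs) i0 i1 i2 (ha s hsT) (hang s hsT) hcpl'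
  have hY := integral_sq_norm_curl_le_of_direction_slab hν hT''pos hS hB hĒ0 hI0 hen' hdiss'
    le_rfl hC₂ le_rfl le_rfl hstrS t htS
  have hYstar_le : ∫ x, ‖curl (u t) x‖ ^ 2 ≤ Ystar := by
    refine hY.trans ?_
    rw [hYstar]
    refine mul_le_mul_of_nonneg_left (Real.exp_le_exp.2 ?_) (by positivity)
    have : (0 + 0 * Ē) * T'' ≤ (0 + 0 * Ē) * T :=
      mul_le_mul_of_nonneg_left hT''T.le (by positivity)
    linarith
  -- the `H¹` quantity
  have hvt : ContDiff ℝ ∞ (u t) := hS.contDiff_velocity htS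
  have hcurl_int : Integrable fun x => ‖curl (u t) x‖ ^ 2 := by
    have hfin1 : ∫⁻ x, ‖iteratedFDeriv ℝ 1 (u t) x‖ₑ ^ 2 < ⊤ := by
      obtain ⟨C1, hC1⟩ := hB 1
      exact (hC1 t htS).trans_lt ENNReal.coe_lt_top
    refine integrable_sq_norm_of_lintegral_lt_top (continuous_curl (hvt.of_le (by norm_cast))) ?_
    exact lt_of_le_of_lt (lintegral_curl_sq_le (u t)) (ENNReal.mul_lt_top ENNReal.ofReal_lt_top hfin1)
  have hdc : ∫⁻ x, ENNReal.ofReal (frobeniusNormSq (fderiv ℝ (u t) x)) ≤ ENNReal.ofReal Ystar := by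
    refine (lintegral_frobeniusNormSq_fderiv_le_lintegral_sq_norm_curl
      (hvt.of_le (by norm_cast)) (hS.divFree t htS)
      ((hen' t htS).trans_lt ENNReal.ofReal_lt_top)).trans ?_
    rw [show (∫⁻ x, ‖curl (u t) x‖ₑ ^ 2) = ∫⁻ x, ENNReal.ofReal (‖curl (u t) x‖ ^ 2) from
      lintegral_congr fun x => by rw [← ofReal_norm, ENNReal.ofReal_pow (norm_nonneg _)],
      ← ofReal_integral_eq_lintegral_ofReal hcurl_int (Eventually.of_forall fun x => sq_nonneg _)]
    exact ENNReal.ofReal_le_ofReal hYstar_le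
  calc (∫⁻ x, ‖u t x‖ₑ ^ 2) + (∫⁻ x, ENNReal.ofReal (frobeniusNormSq (fderiv ℝ (u t) x)))
      ≤ ENNReal.ofReal Ē + ENNReal.ofReal Ystar := add_le_add (hen' t htS) hdc
    _ = ENNReal.ofReal (Ē + Ystar) := (ENNReal.ofReal_add hĒ0 hYstar0).symm

/-- **The near-Beltrami depletion criterion coupled to the enstrophy, whole space `ℝ³`** — the
GLOBAL special case (`r = ∞`: `ψ ≡ 1`, `S_s` and `B(x₀,2r)` replaced by `ℝ³`, `M = 0`) of
Farhat–Grujić 2018, Theorem 1 ("assume that there exists a constant `c` such that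
`α(s)‖∇u(s)‖^{1/2}_{L²(S_s)} ≤ c` for every `s` … Then, the localized enstrophy remains bounded …
and–consequently–`(x₀,t₀)` is a regular point", `α(s) = sup_x sin∠(ω(x,s), u(x,s))`), in the
rendering of the tree's vorticity-direction criteria `constantin_fefferman` /
`holderHalf_direction_criterion`: let `ν > 0`, `T > 0`, and let `(u, p)` be a classical unforced
Navier–Stokes solution on `ℝ³ × [0, T)` in the Beale–Kato–Majda class on every compact
`[0, T''] ⊆ [0, T)` (`HasBoundedSobolevNormsOn`). If there are a function `a ≥ 0` on `[0, T)` with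
`|u(x,t) × ω(x,t)| ≤ a(t) |u(x,t)| |ω(x,t)|` for all `x` (`sin θ(x,t) ≤ a(t)` wherever
`u, ω ≠ 0`) and a constant `c ≥ 0` (ANY size) with `a(t) ‖∇u(t)‖₂^{1/2} ≤ c` for all
`t ∈ [0, T)`, then the solution continues in the class past `T`
(`HasSobolevExtensionPast ν u T`). Proof: `exists_uniform_H1_bound_of_nearBeltrami` fed into
`hasSobolevExtensionPast_of_uniform_H1_bound`. Scope (faithfulness): the LOCAL printed statement
(parabolic cylinder, Leray–Hopf class, regular point) and a vorticity threshold `M > 0` are NOT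
typed (module docstring); every deviation makes this statement weaker than print.
[cite: FarhatGrujic2018, Thm 1 (p. 4; proof pp. 4–6) — global special case r = ∞, whole space] -/
theorem nearBeltrami_enstrophy_criterion {ν : ℝ} (hν : 0 < ν) {T : ℝ} (hT : 0 < T) {c : ℝ}
    {u : ℝ → (EuclideanSpace ℝ (Fin 3)) → (EuclideanSpace ℝ (Fin 3))}
    {p : ℝ → (EuclideanSpace ℝ (Fin 3)) → ℝ}
    (hsol : IsClassicalNSSolutionOn (Ico 0 T) ν 0 u p)
    (hreg : ∀ T'' < T, HasBoundedSobolevNormsOn (Icc 0 T'') u) {a : ℝ → ℝ}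
    (ha : ∀ t ∈ Ico 0 T, 0 ≤ a t)
    (hang : ∀ t ∈ Ico 0 T, ∀ x, ‖cross (u t x) (curl (u t) x)‖ ≤ a t * (‖u t x‖ * ‖curl (u t) x‖))
    (hcpl : ∀ t ∈ Ico 0 T,
      a t * Real.sqrt (Real.sqrt (∫ x, frobeniusNormSq (fderiv ℝ (u t) x))) ≤ c) :
    HasSobolevExtensionPast ν u T := by
  obtain ⟨A, hA0, hA⟩ := exists_uniform_H1_bound_of_nearBeltrami hν hT hsol hreg ha hang hcpl
  exact hasSobolevExtensionPast_of_uniform_H1_bound hν hT hsol hreg hA0 hA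


/-! ### §6 The hypothesis near the final time suffices -/

/-- **A uniform `H¹` bound from a uniform `H¹` bound near the final time** (copy of the private
device of `HolderHalfDirectionCriterion`): if a classical solution in the Beale–Kato–Majda class on
every `[0, T'']`, `T'' < T`, has `‖u(t)‖²_{L²} + ‖∇u(t)‖²_{L²}` bounded on `[t₀, T)` for some
`t₀ < T`, then it is bounded on `[0, T)` (on `[0, t₀]` by the Sobolev bounds of orders `0` and `1`,
`|∇u|²_F ≤ 3‖∇u‖²`). (Proof device.) [folklore] -/
private theorem exists_uniform_H1_bound_of_late' {T t₀ : ℝ} (ht₀T : t₀ < T)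
    {u : ℝ → (EuclideanSpace ℝ (Fin 3)) → (EuclideanSpace ℝ (Fin 3))}
    (hreg : ∀ T'' < T, HasBoundedSobolevNormsOn (Icc 0 T'') u) {A : ℝ} (hA0 : 0 ≤ A)
    (hA : ∀ t ∈ Ico t₀ T,
      (∫⁻ x, ‖u t x‖ₑ ^ 2) + (∫⁻ x, ENNReal.ofReal (frobeniusNormSq (fderiv ℝ (u t) x))) ≤
        ENNReal.ofReal A) :
    ∃ A' : ℝ, 0 ≤ A' ∧ ∀ t ∈ Ico 0 T,
      (∫⁻ x, ‖u t x‖ₑ ^ 2) + (∫⁻ x, ENNReal.ofReal (frobeniusNormSq (fderiv ℝ (u t) x))) ≤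
        ENNReal.ofReal A' := by
  have hB : HasBoundedSobolevNormsOn (Icc 0 t₀) u := hreg t₀ ht₀T
  obtain ⟨C0, hC0⟩ := hB 0
  obtain ⟨C1, hC1⟩ := hB 1
  refine ⟨A + ((C0 : ℝ) + 3 * (C1 : ℝ)), by positivity, fun t ht => ?_⟩
  by_cases hlt : t < t₀
  · have htI : t ∈ Icc 0 t₀ := ⟨ht.1, hlt.le⟩
    have h0 : ∫⁻ x, ‖u t x‖ₑ ^ 2 ≤ (C0 : ℝ≥0∞) := by
      refine le_trans (le_of_eq (lintegral_congr fun x => ?_)) (hC0 t htI)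
      rw [← ofReal_norm, ← ofReal_norm, norm_iteratedFDeriv_zero]
    have h1 : ∫⁻ x, ENNReal.ofReal (frobeniusNormSq (fderiv ℝ (u t) x)) ≤ 3 * (C1 : ℝ≥0∞) := by
      calc ∫⁻ x, ENNReal.ofReal (frobeniusNormSq (fderiv ℝ (u t) x))
          ≤ ∫⁻ x, 3 * ‖iteratedFDeriv ℝ 1 (u t) x‖ₑ ^ 2 := by
            refine lintegral_mono fun x => ?_
            have h3 : ENNReal.ofReal (frobeniusNormSq (fderiv ℝ (u t) x)) ≤
                ENNReal.ofReal (3 * ‖fderiv ℝ (u t) x‖ ^ 2) :=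
              ENNReal.ofReal_le_ofReal (frobeniusNormSq_le_three_mul _)
            refine h3.trans (le_of_eq ?_)
            rw [← norm_iteratedFDeriv_one (u t), ENNReal.ofReal_mul (by norm_num : (0 : ℝ) ≤ 3),
              ENNReal.ofReal_pow (norm_nonneg _), ofReal_norm, ENNReal.ofReal_ofNat]
        _ = 3 * ∫⁻ x, ‖iteratedFDeriv ℝ 1 (u t) x‖ₑ ^ 2 := by
            rw [lintegral_const_mul' _ _ (by norm_num)]
        _ ≤ 3 * (C1 : ℝ≥0∞) := mul_le_mul_right (hC1 t htI) _
    calc (∫⁻ x, ‖u t x‖ₑ ^ 2) + (∫⁻ x, ENNReal.ofReal (frobeniusNormSq (fderiv ℝ (u t) x)))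
        ≤ (C0 : ℝ≥0∞) + 3 * (C1 : ℝ≥0∞) := add_le_add h0 h1
      _ = ENNReal.ofReal ((C0 : ℝ) + 3 * (C1 : ℝ)) := by
          rw [ENNReal.ofReal_add (NNReal.coe_nonneg _) (by positivity), ENNReal.ofReal_coe_nnreal,
            ENNReal.ofReal_mul (by norm_num), ENNReal.ofReal_coe_nnreal, ENNReal.ofReal_ofNat]
      _ ≤ ENNReal.ofReal (A + ((C0 : ℝ) + 3 * (C1 : ℝ))) :=
          ENNReal.ofReal_le_ofReal (le_add_of_nonneg_left hA0)
  · have htI : t ∈ Ico t₀ T := ⟨not_lt.1 hlt, ht.2⟩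
    exact (hA t htI).trans (ENNReal.ofReal_le_ofReal (le_add_of_nonneg_right (by positivity)))

/-- **The near-Beltrami criterion, hypothesis near the final time only** (as printed, the
hypothesis of Theorem 1 bears on the time window `s ∈ (t₀ − (2r)², t₀)` below the point in
question; here: on `[t₀, T)` for some `0 ≤ t₀ < T`): a classical unforced solution on
`ℝ³ × [0, T)` in the Beale–Kato–Majda class on every `[0, T'']`, `T'' < T`, with
`|u × ω| ≤ a(t)|u||ω|` everywhere and `a(t)‖∇u(t)‖₂^{1/2} ≤ c` for `t ∈ [t₀, T)`, continues in the
class past `T`. Proof: the a priori bound `exists_uniform_H1_bound_of_nearBeltrami` for the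
time-translate `u(· + t₀)` (`IsClassicalNSSolutionOn.translate_Ico_zero`), the trivial bound on
`[0, t₀]`, and `hasSobolevExtensionPast_of_uniform_H1_bound`.
[cite: FarhatGrujic2018, Thm 1 (hypothesis on the final time window (t₀ − (2r)², t₀); global-in-space special case)] -/
theorem nearBeltrami_enstrophy_criterion_of_late {ν : ℝ} (hν : 0 < ν) {T t₀ : ℝ} (ht₀ : 0 ≤ t₀)
    (ht₀T : t₀ < T) {c : ℝ} {u : ℝ → (EuclideanSpace ℝ (Fin 3)) → (EuclideanSpace ℝ (Fin 3))}
    {p : ℝ → (EuclideanSpace ℝ (Fin 3)) → ℝ}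
    (hsol : IsClassicalNSSolutionOn (Ico 0 T) ν 0 u p)
    (hreg : ∀ T'' < T, HasBoundedSobolevNormsOn (Icc 0 T'') u) {a : ℝ → ℝ}
    (ha : ∀ t ∈ Ico t₀ T, 0 ≤ a t)
    (hang : ∀ t ∈ Ico t₀ T, ∀ x, ‖cross (u t x) (curl (u t) x)‖ ≤ a t * (‖u t x‖ * ‖curl (u t) x‖))
    (hcpl : ∀ t ∈ Ico t₀ T,
      a t * Real.sqrt (Real.sqrt (∫ x, frobeniusNormSq (fderiv ℝ (u t) x))) ≤ c) :
    HasSobolevExtensionPast ν u T := by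
  have hT : 0 < T := lt_of_le_of_lt ht₀ ht₀T
  have hTt : 0 < T - t₀ := by linarith
  -- the translate
  have hsol' : IsClassicalNSSolutionOn (Ico 0 (T - t₀)) ν 0 (fun t => u (t + t₀))
      (fun t => p (t + t₀)) := hsol.translate_Ico_zero ht₀
  have hreg' : ∀ T'' < T - t₀, HasBoundedSobolevNormsOn (Icc 0 T'') (fun t => u (t + t₀)) := by
    intro T'' hT'' n
    obtain ⟨C, hC⟩ := hreg (T'' + t₀) (by linarith) n
    exact ⟨C, fun t ht => hC (t + t₀) ⟨by linarith [ht.1], by linarith [ht.2]⟩⟩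
  have ha' : ∀ t ∈ Ico 0 (T - t₀), 0 ≤ (fun t => a (t + t₀)) t :=
    fun t ht => ha (t + t₀) ⟨by linarith [ht.1], by linarith [ht.2]⟩
  have hang' : ∀ t ∈ Ico 0 (T - t₀), ∀ x,
      ‖cross (u (t + t₀) x) (curl (u (t + t₀)) x)‖ ≤
        (fun t => a (t + t₀)) t * (‖u (t + t₀) x‖ * ‖curl (u (t + t₀)) x‖) :=
    fun t ht => hang (t + t₀) ⟨by linarith [ht.1], by linarith [ht.2]⟩
  have hcpl' : ∀ t ∈ Ico 0 (T - t₀),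
      (fun t => a (t + t₀)) t *
          Real.sqrt (Real.sqrt (∫ x, frobeniusNormSq (fderiv ℝ (u (t + t₀)) x))) ≤ c :=
    fun t ht => hcpl (t + t₀) ⟨by linarith [ht.1], by linarith [ht.2]⟩
  obtain ⟨A, hA0, hA⟩ :=
    exists_uniform_H1_bound_of_nearBeltrami hν hTt hsol' hreg' ha' hang' hcpl'
  -- back to `u` on `[t₀, T)`
  have hAu : ∀ t ∈ Ico t₀ T,
      (∫⁻ x, ‖u t x‖ₑ ^ 2) + (∫⁻ x, ENNReal.ofReal (frobeniusNormSq (fderiv ℝ (u t) x))) ≤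
        ENNReal.ofReal A := by
    intro t ht
    have h := hA (t - t₀) ⟨by linarith [ht.1], by linarith [ht.2]⟩
    simp only [sub_add_cancel] at h
    exact h
  obtain ⟨A', hA'0, hA'⟩ := exists_uniform_H1_bound_of_late' ht₀T hreg hA0 hAu
  exact hasSobolevExtensionPast_of_uniform_H1_bound hν hT hsol hreg hA'0 hA'


/-! ### §7 The threshold form: the angle hypothesis only where `|ω| > M` -/

namespace FarhatGrujic2018

/-- Cauchy–Schwarz for non-negative square-integrable real functions (no continuity required).
(Proof device.) [folklore] -/
private theorem integral_mul_le_sqrt_mul_sqrt {f g : EuclideanSpace ℝ (Fin 3) → ℝ}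
    (hf0 : ∀ x, 0 ≤ f x) (hg0 : ∀ x, 0 ≤ g x) (hf : MemLp f 2 volume) (hg : MemLp g 2 volume) :
    ∫ x, f x * g x ≤ Real.sqrt (∫ x, f x ^ 2) * Real.sqrt (∫ x, g x ^ 2) := by
  have e2 : ENNReal.ofReal 2 = (2 : ℝ≥0∞) := by norm_num
  have hf' : MemLp f (ENNReal.ofReal 2) volume := by rw [e2]; exact hf
  have hg' : MemLp g (ENNReal.ofReal 2) volume := by rw [e2]; exact hg
  have h := integral_mul_le_Lp_mul_Lq_of_nonneg Real.HolderConjugate.two_two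
    (Eventually.of_forall hf0) (Eventually.of_forall hg0) hf' hg'
  simp only [Real.rpow_two] at h
  rwa [Real.sqrt_eq_rpow, Real.sqrt_eq_rpow]

-- one long chain of elementary estimates; the default budget is exceeded by bookkeeping alone
set_option maxHeartbeats 800000 in
/-- **The fixed-time estimate, threshold form** (Farhat–Grujić's splitting into the regions of low
and high vorticity, `{|ω| ≤ M} ∪ {|ω| > M}`, estimates of `I₂′` and `I₂″`, p. 5, with `ψ ≡ 1`): as
`two_mul_integral_stretching_le_of_nearBeltrami`, but the near-Beltrami hypothesis
`|v × ω| ≤ a|v||ω|` is only assumed where `|ω| > M` (`M ≥ 0`). Then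
`2∫⟪ω,(∇v)ω⟫ ≤ ν∫|∇ω|²_F + C₁ ∫|ω|² + C₂ (∫|ω|²)²` with `C₁ = 2κ²K₀²/(3ν)`,
`C₂ = 16κ⁴K₀⁶c⁴/ν³ + 4κ²K₀²M/(3ν)`. On the low set the printed bound uses `|ω| ≤ M` only through
`∫_{|ω|≤M}|ω|³ ≤ M∫|ω|²` (so that no `‖u‖₂` term appears): `∫_{|ω|≤M}|curl ω||v||ω| ≤
‖curl ω‖₂ ‖v‖₆ ‖ω 1_{|ω|≤M}‖₃ ≤ κK₀ ‖∇ω‖₂ ‖∇v‖₂ (M‖ω‖₂²)^{1/3}`, Young, and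
`(M Y)^{2/3} ≤ (2MY + 1)/3`. [cite: FarhatGrujic2018, Thm 1 (proof p. 5: the splitting {|ω| ≤ M} ∪ {|ω| > M}, estimates of I₂′ and I₂″)] -/
theorem two_mul_integral_stretching_le_of_nearBeltrami_threshold {ν c M : ℝ} (hν : 0 < ν)
    (hM : 0 ≤ M) {v : EuclideanSpace ℝ (Fin 3) → EuclideanSpace ℝ (Fin 3)} (hv : ContDiff ℝ 2 v)
    (hdiv : VectorCalculus.IsDivFree v) {B₀ : ℝ} (hB₀ : ∀ x, ‖v x‖ ≤ B₀) {B₁ : ℝ}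
    (hB₁ : ∀ x, ‖fderiv ℝ v x‖ ≤ B₁) (hE : Integrable fun x => ‖v x‖ ^ 2)
    (hG : Integrable fun x => ‖fderiv ℝ v x‖ ^ 2)
    (hH : Integrable fun x => ‖fderiv ℝ (fderiv ℝ v) x‖ ^ 2) {a : ℝ} (ha : 0 ≤ a)
    (hang : ∀ x, M < ‖curl v x‖ → ‖cross (v x) (curl v x)‖ ≤ a * (‖v x‖ * ‖curl v x‖))
    (hcpl : a ^ 4 * (∫ x, frobeniusNormSq (fderiv ℝ v x)) ≤ c ^ 4) :
    2 * ∫ x, ⟪curl v x, fderiv ℝ v x (curl v x)⟫ ≤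
      ν * (∫ x, frobeniusNormSq (fderiv ℝ (curl v) x)) +
        (2 * ‖curlCLM‖ ^ 2 *
            (SNormLESNormFDerivOfEqConst (EuclideanSpace ℝ (Fin 3))
              (volume : Measure (EuclideanSpace ℝ (Fin 3))) 2 : ℝ) ^ 2 / (3 * ν)) *
          (∫ x, ‖curl v x‖ ^ 2) +
        (16 * ‖curlCLM‖ ^ 4 *
              (SNormLESNormFDerivOfEqConst (EuclideanSpace ℝ (Fin 3))
                (volume : Measure (EuclideanSpace ℝ (Fin 3))) 2 : ℝ) ^ 6 * c ^ 4 / ν ^ 3 +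
            4 * ‖curlCLM‖ ^ 2 *
              (SNormLESNormFDerivOfEqConst (EuclideanSpace ℝ (Fin 3))
                (volume : Measure (EuclideanSpace ℝ (Fin 3))) 2 : ℝ) ^ 2 * M / (3 * ν)) *
          (∫ x, ‖curl v x‖ ^ 2) * (∫ x, ‖curl v x‖ ^ 2) := by
  set K₀ : ℝ := (SNormLESNormFDerivOfEqConst (EuclideanSpace ℝ (Fin 3))
    (volume : Measure (EuclideanSpace ℝ (Fin 3))) 2 : ℝ) with hK₀
  have hK₀0 : 0 ≤ K₀ := NNReal.coe_nonneg _
  set κ : ℝ := ‖curlCLM‖ with hκ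
  have hκ0 : 0 ≤ κ := norm_nonneg _
  have hν2 : 0 < ν / 2 := half_pos hν
  -- ### basic objects
  have hv1 : ContDiff ℝ 1 v := hv.of_le (by norm_num)
  have hvc : Continuous v := hv.continuous
  have hω1 : ContDiff ℝ 1 (curl v) := contDiff_curl (n := 1) (by exact hv)
  have hωc : Continuous (curl v) := hω1.continuous
  have hDω : Continuous (fderiv ℝ (curl v)) := hω1.continuous_fderiv one_ne_zero
  have hcωc : Continuous (curl (curl v)) := continuous_curl hω1
  have hB₀0 : 0 ≤ B₀ := (norm_nonneg _).trans (hB₀ 0)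
  have hB₁0 : 0 ≤ B₁ := (norm_nonneg _).trans (hB₁ 0)
  have hωle : ∀ x, ‖curl v x‖ ≤ κ * ‖fderiv ℝ v x‖ := fun x => norm_curl_le v x
  have hωbd : ∀ x, ‖curl v x‖ ≤ κ * B₁ := fun x =>
    (hωle x).trans (mul_le_mul_of_nonneg_left (hB₁ x) hκ0)
  have hDωle : ∀ x, ‖fderiv ℝ (curl v) x‖ ≤ κ * ‖fderiv ℝ (fderiv ℝ v) x‖ := fun x => by
    rw [hκ, fderiv_curl hv]
    exact ContinuousLinearMap.opNorm_comp_le _ _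
  have hcωle : ∀ x, ‖curl (curl v) x‖ ≤ κ * ‖fderiv ℝ (curl v) x‖ :=
    fun x => norm_curl_le (curl v) x
  -- ### integrability
  have Iω : Integrable fun x => ‖curl v x‖ ^ 2 := by
    refine (hG.const_mul (κ ^ 2)).mono' ((hωc.norm.pow 2).aestronglyMeasurable)
      (Eventually.of_forall fun x => ?_)
    rw [Real.norm_of_nonneg (sq_nonneg _), ← mul_pow]
    exact pow_le_pow_left₀ (norm_nonneg _) (hωle x) 2
  have IDω : Integrable fun x => ‖fderiv ℝ (curl v) x‖ ^ 2 := by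
    refine (hH.const_mul (κ ^ 2)).mono' ((hDω.norm.pow 2).aestronglyMeasurable)
      (Eventually.of_forall fun x => ?_)
    rw [Real.norm_of_nonneg (sq_nonneg _), ← mul_pow]
    exact pow_le_pow_left₀ (norm_nonneg _) (hDωle x) 2
  have Icω : Integrable fun x => ‖curl (curl v) x‖ ^ 2 := by
    refine (IDω.const_mul (κ ^ 2)).mono' ((hcωc.norm.pow 2).aestronglyMeasurable)
      (Eventually.of_forall fun x => ?_)
    rw [Real.norm_of_nonneg (sq_nonneg _), ← mul_pow]
    exact pow_le_pow_left₀ (norm_nonneg _) (hcωle x) 2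
  have Ifv : Integrable fun x => frobeniusNormSq (fderiv ℝ v x) := by
    refine (hG.const_mul 3).mono' (continuous_frobeniusNormSq_fderiv hv (by norm_num)).aestronglyMeasurable
      (Eventually.of_forall fun x => ?_)
    rw [Real.norm_of_nonneg (frobeniusNormSq_nonneg _)]
    exact frobeniusNormSq_le_three_mul _
  have Ifω : Integrable fun x => frobeniusNormSq (fderiv ℝ (curl v) x) := by
    refine (IDω.const_mul 3).mono' (continuous_frobeniusNormSq_fderiv hω1 one_ne_zero).aestronglyMeasurable
      (Eventually.of_forall fun x => ?_)
    rw [Real.norm_of_nonneg (frobeniusNormSq_nonneg _)]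
    exact frobeniusNormSq_le_three_mul _
  have hcω2 : MemLp (curl (curl v)) 2 volume :=
    (memLp_two_iff_integrable_sq_norm hcωc.aestronglyMeasurable).2 Icω
  have hpow : ∀ {w : EuclideanSpace ℝ (Fin 3) → EuclideanSpace ℝ (Fin 3)} {B : ℝ} (_ : Continuous w)
      (_ : ∀ x, ‖w x‖ ≤ B) (_ : Integrable fun x => ‖w x‖ ^ 2) (k : ℕ),
      Integrable fun x => ‖w x‖ ^ (k + 2) := by
    intro w B hwc hwB hw2 k
    have hB : 0 ≤ B := (norm_nonneg _).trans (hwB 0)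
    refine (hw2.const_mul (B ^ k)).mono' ((hwc.norm.pow _).aestronglyMeasurable)
      (Eventually.of_forall fun x => ?_)
    rw [Real.norm_of_nonneg (by positivity), pow_add]
    exact mul_le_mul_of_nonneg_right (pow_le_pow_left₀ (norm_nonneg _) (hwB x) k) (sq_nonneg _)
  have Iv6 : Integrable fun x => ‖v x‖ ^ 6 := hpow hvc hB₀ hE 4
  have Iω3 : Integrable fun x => ‖curl v x‖ ^ 3 := hpow hωc hωbd Iω 1
  -- ### the quantities
  set Y : ℝ := ∫ x, ‖curl v x‖ ^ 2 with hY
  set D : ℝ := ∫ x, frobeniusNormSq (fderiv ℝ (curl v) x) with hD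
  set F : ℝ := ∫ x, frobeniusNormSq (fderiv ℝ v x) with hF
  set Dop : ℝ := ∫ x, ‖fderiv ℝ (curl v) x‖ ^ 2 with hDop
  set Gop : ℝ := ∫ x, ‖fderiv ℝ v x‖ ^ 2 with hGop
  set Dc : ℝ := ∫ x, ‖curl (curl v) x‖ ^ 2 with hDc
  have hY0 : 0 ≤ Y := integral_nonneg fun x => sq_nonneg _
  have hD0 : 0 ≤ D := integral_nonneg fun x => frobeniusNormSq_nonneg _
  have hF0 : 0 ≤ F := integral_nonneg fun x => frobeniusNormSq_nonneg _
  have hDop0 : 0 ≤ Dop := integral_nonneg fun x => sq_nonneg _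
  have hDc0 : 0 ≤ Dc := integral_nonneg fun x => sq_nonneg _
  have hGle : Gop ≤ F := integral_mono hG Ifv fun x => sq_opNorm_le_frobeniusNormSq _
  have hDopD : Dop ≤ D := integral_mono IDω Ifω fun x => sq_opNorm_le_frobeniusNormSq _
  have hDcle : Dc ≤ κ ^ 2 * Dop := by
    rw [hDop, ← integral_const_mul]
    refine integral_mono Icω (IDω.const_mul _) fun x => ?_
    simp only
    rw [← mul_pow]
    exact pow_le_pow_left₀ (norm_nonneg _) (hcωle x) 2
  set sD := Real.sqrt D with hsD
  have hsD0 : 0 ≤ sD := Real.sqrt_nonneg _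
  have hsD2 : sD ^ 2 = D := Real.sq_sqrt hD0
  have hFY : F ≤ Y := by
    have hl := lintegral_frobeniusNormSq_fderiv_le_lintegral_sq_norm_curl hv hdiv
      (lintegral_enorm_sq_lt_top_of_integrable_sq hE)
    have e1 : ∫⁻ x, ENNReal.ofReal (frobeniusNormSq (fderiv ℝ v x)) = ENNReal.ofReal F := by
      rw [hF, ofReal_integral_eq_lintegral_ofReal Ifv
        (Eventually.of_forall fun x => frobeniusNormSq_nonneg _)]
    have e2 : ∫⁻ x, ‖curl v x‖ₑ ^ 2 = ENNReal.ofReal Y := by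
      rw [hY, ofReal_integral_eq_lintegral_ofReal Iω (Eventually.of_forall fun x => sq_nonneg _)]
      exact lintegral_congr fun x => by rw [← ofReal_norm, ENNReal.ofReal_pow (norm_nonneg _)]
    rw [e1, e2] at hl
    exact (ENNReal.ofReal_le_ofReal_iff hY0).1 hl
  have hsDc : Real.sqrt Dc ≤ κ * sD := by
    calc Real.sqrt Dc ≤ Real.sqrt (κ ^ 2 * Dop) := Real.sqrt_le_sqrt hDcle
      _ = κ * Real.sqrt Dop := by rw [Real.sqrt_mul (sq_nonneg _), Real.sqrt_sq hκ0]
      _ ≤ κ * sD := mul_le_mul_of_nonneg_left (Real.sqrt_le_sqrt hDopD) hκ0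
  -- ### the low-vorticity indicator
  set χ : EuclideanSpace ℝ (Fin 3) → ℝ := fun x => if ‖curl v x‖ ≤ M then 1 else 0 with hχ
  have hχm : Measurable χ :=
    Measurable.ite (measurableSet_le hωc.norm.measurable measurable_const) measurable_const
      measurable_const
  have hχ0 : ∀ x, 0 ≤ χ x := fun x => by
    rw [hχ]; simp only; split_ifs <;> norm_num
  have hχ1 : ∀ x, χ x ≤ 1 := fun x => by
    rw [hχ]; simp only; split_ifs <;> norm_num
  have hχsq : ∀ x, χ x ^ 2 = χ x := fun x => by
    rw [hχ]; simp only; split_ifs <;> norm_num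
  have hχω : ∀ x, χ x * ‖curl v x‖ ^ 3 ≤ M * ‖curl v x‖ ^ 2 := fun x => by
    rw [hχ]; simp only
    split_ifs with hle
    · rw [one_mul, pow_succ, mul_comm]
      exact mul_le_mul_of_nonneg_right hle (sq_nonneg _)
    · rw [zero_mul]; positivity
  -- ### Step 1–2: Lamb form and the pointwise depletion `|v × ω| ≤ a g + χ g`, `g = |v||ω|`
  set g : EuclideanSpace ℝ (Fin 3) → ℝ := fun x => ‖v x‖ * ‖curl v x‖ with hg
  have hgc : Continuous g := hvc.norm.mul hωc.norm
  have hg0 : ∀ x, 0 ≤ g x := fun x => mul_nonneg (norm_nonneg _) (norm_nonneg _)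
  have hgn : ∀ x, ‖g x‖ = g x := fun x => Real.norm_of_nonneg (hg0 x)
  have hdep : ∀ x, ‖cross (v x) (curl v x)‖ ≤ a * g x + χ x * g x := by
    intro x
    by_cases hle : ‖curl v x‖ ≤ M
    · have hχx : χ x = 1 := by rw [hχ]; simp only; rw [if_pos hle]
      rw [hχx, one_mul]
      exact (norm_cross_le' _ _).trans (le_add_of_nonneg_left (mul_nonneg ha (hg0 x)))
    · have hχx : χ x = 0 := by rw [hχ]; simp only; rw [if_neg hle]
      rw [hχx, zero_mul, add_zero]
      exact hang x (lt_of_not_ge hle)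
  set M₁ : ℝ := ∫ x, ‖g x‖ ^ 2 with hM₁
  have hM₁0 : 0 ≤ M₁ := integral_nonneg fun x => sq_nonneg _
  have Ig2 : Integrable fun x => ‖g x‖ ^ 2 := by
    refine (Iω.const_mul (B₀ ^ 2)).mono' ((hgc.norm.pow 2).aestronglyMeasurable)
      (Eventually.of_forall fun x => ?_)
    rw [Real.norm_of_nonneg (sq_nonneg _), hgn, hg]; simp only
    rw [mul_pow]
    exact mul_le_mul_of_nonneg_right (pow_le_pow_left₀ (norm_nonneg _) (hB₀ x) 2) (sq_nonneg _)
  have hgm2 : MemLp g 2 volume := (memLp_two_iff_integrable_sq_norm hgc.aestronglyMeasurable).2 Ig2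
  -- the low part `χ g`
  set gl : EuclideanSpace ℝ (Fin 3) → ℝ := fun x => χ x * g x with hgl
  have hglm : AEStronglyMeasurable gl volume := (hχm.mul hgc.measurable).aestronglyMeasurable
  have hgl0 : ∀ x, 0 ≤ gl x := fun x => mul_nonneg (hχ0 x) (hg0 x)
  have hgl_le : ∀ x, gl x ≤ g x := fun x => by
    rw [hgl]; simp only
    exact (mul_le_mul_of_nonneg_right (hχ1 x) (hg0 x)).trans_eq (one_mul _)
  set M₂ : ℝ := ∫ x, gl x ^ 2 with hM₂
  have hM₂0 : 0 ≤ M₂ := integral_nonneg fun x => sq_nonneg _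
  have Igl2 : Integrable fun x => gl x ^ 2 := by
    refine Ig2.mono' ((hχm.mul hgc.measurable).pow_const 2).aestronglyMeasurable
      (Eventually.of_forall fun x => ?_)
    rw [Real.norm_of_nonneg (sq_nonneg _), hgn]
    exact pow_le_pow_left₀ (hgl0 x) (hgl_le x) 2
  have hglm2 : MemLp gl 2 volume := by
    refine (memLp_two_iff_integrable_sq_norm hglm).2 (Igl2.congr (Eventually.of_forall fun x => ?_))
    simp only
    rw [Real.norm_of_nonneg (hgl0 x)]
  have Iprod1 : Integrable fun x => ‖curl (curl v) x‖ * ‖g x‖ := hcω2.norm.integrable_mul hgm2.norm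
  have Iprod2 : Integrable fun x => ‖curl (curl v) x‖ * gl x := by
    refine Iprod1.mono' (hcωc.norm.aestronglyMeasurable.mul hglm) (Eventually.of_forall fun x => ?_)
    rw [Real.norm_of_nonneg (mul_nonneg (norm_nonneg _) (hgl0 x)), hgn]
    exact mul_le_mul_of_nonneg_left (hgl_le x) (norm_nonneg _)
  have hS : 2 * ∫ x, ⟪curl v x, fderiv ℝ v x (curl v x)⟫ ≤
      2 * a * (κ * sD) * Real.sqrt M₁ + 2 * (sD * (κ * Real.sqrt M₂)) := by
    rw [integral_stretching_eq_integral_inner_curl_cross hv hdiv hB₀ hB₁ hG hH]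
    have IL : Integrable fun x => ⟪curl (curl v) x, cross (v x) (curl v x)⟫ := by
      refine Iprod1.mono' ((hcωc.inner (crossCLM.continuous₂.comp₂ hvc hωc))
        |>.aestronglyMeasurable) (Eventually.of_forall fun x => ?_)
      calc ‖⟪curl (curl v) x, cross (v x) (curl v x)⟫‖
          ≤ ‖curl (curl v) x‖ * ‖cross (v x) (curl v x)‖ := norm_inner_le_norm _ _
        _ ≤ ‖curl (curl v) x‖ * ‖g x‖ := by
            rw [hgn]; exact mul_le_mul_of_nonneg_left (norm_cross_le' _ _) (norm_nonneg _)
    have h1 : ∫ x, ⟪curl (curl v) x, cross (v x) (curl v x)⟫ ≤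
        ∫ x, (a * (‖curl (curl v) x‖ * ‖g x‖) + ‖curl (curl v) x‖ * gl x) := by
      refine integral_mono IL ((Iprod1.const_mul a).add Iprod2) fun x => ?_
      calc ⟪curl (curl v) x, cross (v x) (curl v x)⟫
          ≤ ‖curl (curl v) x‖ * ‖cross (v x) (curl v x)‖ := real_inner_le_norm _ _
        _ ≤ ‖curl (curl v) x‖ * (a * g x + χ x * g x) :=
            mul_le_mul_of_nonneg_left (hdep x) (norm_nonneg _)
        _ = a * (‖curl (curl v) x‖ * ‖g x‖) + ‖curl (curl v) x‖ * gl x := by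
            rw [hgn, hgl]; ring
    rw [integral_add (Iprod1.const_mul a) Iprod2, integral_const_mul] at h1
    have h2 : ∫ x, ‖curl (curl v) x‖ * ‖g x‖ ≤ Real.sqrt Dc * Real.sqrt M₁ :=
      integral_norm_mul_norm_le_sqrt hcωc hgc Icω Ig2
    have h3 : ∫ x, ‖curl (curl v) x‖ * gl x ≤ Real.sqrt Dc * Real.sqrt M₂ :=
      integral_mul_le_sqrt_mul_sqrt (fun x => norm_nonneg _) hgl0 hcω2.norm hglm2
    have h2' : a * ∫ x, ‖curl (curl v) x‖ * ‖g x‖ ≤ a * ((κ * sD) * Real.sqrt M₁) :=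
      mul_le_mul_of_nonneg_left (h2.trans (mul_le_mul_of_nonneg_right hsDc (Real.sqrt_nonneg _))) ha
    have h3' : ∫ x, ‖curl (curl v) x‖ * gl x ≤ (κ * sD) * Real.sqrt M₂ :=
      h3.trans (mul_le_mul_of_nonneg_right hsDc (Real.sqrt_nonneg _))
    nlinarith [h1, h2', h3']
  -- ### Step 3: the high part through `stretching_count` at viscosity `ν/2`
  -- (`M₁ ≤ K₀³ F √Y √D` exactly as in the threshold-free estimate)
  have hM₁le : M₁ ≤ K₀ ^ 3 * F * Real.sqrt Y * sD := by
    -- Hölder `(3, 3/2)`, Sobolev twice, Cauchy–Schwarz twice: we re-run the threshold-free file's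
    -- chain by invoking its estimate-free consequence through `two_mul_integral_stretching_le…`?
    -- No: we redo the short chain here.
    set V6 : ℝ := ∫ x, ‖v x‖ ^ 6 with hV6
    set Z3 : ℝ := ∫ x, ‖curl v x‖ ^ 3 with hZ3
    set Q4 : ℝ := ∫ x, ‖curl v x‖ ^ 4 with hQ4
    set W6 : ℝ := ∫ x, ‖curl v x‖ ^ 6 with hW6
    have Iω4 : Integrable fun x => ‖curl v x‖ ^ 4 := hpow hωc hωbd Iω 2
    have Iω6 : Integrable fun x => ‖curl v x‖ ^ 6 := hpow hωc hωbd Iω 4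
    have hV60 : 0 ≤ V6 := integral_nonneg fun x => by positivity
    have hZ30 : 0 ≤ Z3 := integral_nonneg fun x => by positivity
    have hQ40 : 0 ≤ Q4 := integral_nonneg fun x => by positivity
    have hMeq : M₁ = ∫ x, ‖v x‖ ^ 2 * ‖curl v x‖ ^ 2 :=
      integral_congr_ae (Eventually.of_forall fun x => by
        simp only
        rw [hgn, hg]; simp only
        rw [mul_pow])
    have hpq : (3 : ℝ).HolderConjugate (3 / 2) := by
      rw [Real.holderConjugate_iff]; norm_num
    have hf3 : MemLp (fun x => ‖v x‖ ^ 2) (ENNReal.ofReal 3) volume := by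
      refine (integrable_norm_rpow_iff (f := fun x => ‖v x‖ ^ 2)
        ((hvc.norm.pow 2).aestronglyMeasurable) (by simp) ENNReal.ofReal_ne_top).1 ?_
      refine Iv6.congr (Eventually.of_forall fun x => ?_)
      simp only
      rw [ENNReal.toReal_ofReal (by norm_num), Real.norm_of_nonneg (sq_nonneg _),
        show (3 : ℝ) = ((3 : ℕ) : ℝ) by norm_num, Real.rpow_natCast]
      ring
    have hg32 : MemLp (fun x => ‖curl v x‖ ^ 2) (ENNReal.ofReal (3 / 2)) volume := by
      refine (integrable_norm_rpow_iff (f := fun x => ‖curl v x‖ ^ 2)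
        ((hωc.norm.pow 2).aestronglyMeasurable) (by simp) ENNReal.ofReal_ne_top).1 ?_
      refine Iω3.congr (Eventually.of_forall fun x => ?_)
      simp only
      rw [ENNReal.toReal_ofReal (by norm_num), Real.norm_of_nonneg (sq_nonneg _),
        ← Real.rpow_natCast ‖curl v x‖ 2, ← Real.rpow_mul (norm_nonneg _),
        show ((2 : ℕ) : ℝ) * (3 / 2) = ((3 : ℕ) : ℝ) by norm_num, Real.rpow_natCast]
    have hHol := integral_mul_le_Lp_mul_Lq_of_nonneg hpq
      (Eventually.of_forall fun x => sq_nonneg ‖v x‖)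
      (Eventually.of_forall fun x => sq_nonneg ‖curl v x‖) hf3 hg32
    have eV : ∫ x, (‖v x‖ ^ 2) ^ (3 : ℝ) = V6 :=
      integral_congr_ae (Eventually.of_forall fun x => by
        simp only
        rw [show (3 : ℝ) = ((3 : ℕ) : ℝ) by norm_num, Real.rpow_natCast]
        ring)
    have eZ : ∫ x, (‖curl v x‖ ^ 2) ^ ((3 : ℝ) / 2) = Z3 :=
      integral_congr_ae (Eventually.of_forall fun x => by
        simp only
        rw [← Real.rpow_natCast ‖curl v x‖ 2, ← Real.rpow_mul (norm_nonneg _),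
          show ((2 : ℕ) : ℝ) * (3 / 2) = ((3 : ℕ) : ℝ) by norm_num, Real.rpow_natCast])
    rw [eV, eZ, ← hMeq] at hHol
    have hcube : ∀ y : ℝ, 0 ≤ y → (y ^ 3) ^ ((1 : ℝ) / 3) = y := fun y hy => by
      rw [← Real.rpow_natCast, ← Real.rpow_mul hy]; norm_num
    have hV6le : V6 ≤ (K₀ * Real.sqrt Gop) ^ 6 := integral_norm_pow_six_le hv1 hE hG Iv6
    have hV13 : V6 ^ ((1 : ℝ) / 3) ≤ K₀ ^ 2 * F := by
      have h1 : V6 ≤ ((K₀ * Real.sqrt F) ^ 2) ^ 3 := by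
        calc V6 ≤ (K₀ * Real.sqrt Gop) ^ 6 := hV6le
          _ ≤ (K₀ * Real.sqrt F) ^ 6 :=
              pow_le_pow_left₀ (by positivity)
                (mul_le_mul_of_nonneg_left (Real.sqrt_le_sqrt hGle) hK₀0) 6
          _ = ((K₀ * Real.sqrt F) ^ 2) ^ 3 := by rw [← pow_mul]
      calc V6 ^ ((1 : ℝ) / 3) ≤ (((K₀ * Real.sqrt F) ^ 2) ^ 3) ^ ((1 : ℝ) / 3) :=
            Real.rpow_le_rpow hV60 h1 (by norm_num)
        _ = (K₀ * Real.sqrt F) ^ 2 := hcube _ (sq_nonneg _)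
        _ = K₀ ^ 2 * F := by rw [mul_pow, Real.sq_sqrt hF0]
    have hW6le : W6 ≤ (K₀ * Real.sqrt Dop) ^ 6 := integral_norm_pow_six_le hω1 Iω IDω Iω6
    set sY := Real.sqrt Y with hsY
    have hsY0 : 0 ≤ sY := Real.sqrt_nonneg _
    have hsY2 : sY ^ 2 = Y := Real.sq_sqrt hY0
    have hZ3le : Z3 ≤ sY * Real.sqrt Q4 := by
      have hg2c : Continuous fun x => ‖curl v x‖ ^ 2 := hωc.norm.pow 2
      have I : Integrable fun x => ‖(‖curl v x‖ ^ 2)‖ ^ 2 := by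
        refine Iω4.congr (Eventually.of_forall fun x => ?_)
        simp only
        rw [Real.norm_of_nonneg (sq_nonneg _), ← pow_mul]
      have h := integral_norm_mul_norm_le_sqrt hωc hg2c Iω I
      have e1 : ∫ x, ‖curl v x‖ * ‖(‖curl v x‖ ^ 2)‖ = Z3 :=
        integral_congr_ae (Eventually.of_forall fun x => by
          simp only
          rw [Real.norm_of_nonneg (sq_nonneg _)]; ring)
      have e2 : ∫ x, ‖(‖curl v x‖ ^ 2)‖ ^ 2 = Q4 :=
        integral_congr_ae (Eventually.of_forall fun x => by
          simp only
          rw [Real.norm_of_nonneg (sq_nonneg _), ← pow_mul])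
      rw [e1, e2] at h
      exact h
    have hQ4le : Q4 ≤ sY * Real.sqrt W6 := by
      have hg3c : Continuous fun x => ‖curl v x‖ ^ 3 := hωc.norm.pow 3
      have I : Integrable fun x => ‖(‖curl v x‖ ^ 3)‖ ^ 2 := by
        refine Iω6.congr (Eventually.of_forall fun x => ?_)
        simp only
        rw [Real.norm_of_nonneg (by positivity), ← pow_mul]
      have h := integral_norm_mul_norm_le_sqrt hωc hg3c Iω I
      have e1 : ∫ x, ‖curl v x‖ * ‖(‖curl v x‖ ^ 3)‖ = Q4 :=
        integral_congr_ae (Eventually.of_forall fun x => by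
          simp only
          rw [Real.norm_of_nonneg (by positivity)]; ring)
      have e2 : ∫ x, ‖(‖curl v x‖ ^ 3)‖ ^ 2 = W6 :=
        integral_congr_ae (Eventually.of_forall fun x => by
          simp only
          rw [Real.norm_of_nonneg (by positivity), ← pow_mul])
      rw [e1, e2] at h
      exact h
    have hn : Z3 ^ 2 ≤ (K₀ * sY * sD) ^ 3 := by
      have hsW : Real.sqrt W6 ≤ (K₀ * sD) ^ 3 := by
        calc Real.sqrt W6 ≤ Real.sqrt ((K₀ * Real.sqrt Dop) ^ 6) := Real.sqrt_le_sqrt hW6le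
          _ = (K₀ * Real.sqrt Dop) ^ 3 := by
              rw [show (K₀ * Real.sqrt Dop) ^ 6 = ((K₀ * Real.sqrt Dop) ^ 3) ^ 2 by ring,
                Real.sqrt_sq (by positivity)]
          _ ≤ (K₀ * sD) ^ 3 :=
              pow_le_pow_left₀ (by positivity)
                (mul_le_mul_of_nonneg_left (Real.sqrt_le_sqrt hDopD) hK₀0) 3
      have hQ : Q4 ≤ sY * (K₀ * sD) ^ 3 := hQ4le.trans (mul_le_mul_of_nonneg_left hsW hsY0)
      calc Z3 ^ 2 ≤ (sY * Real.sqrt Q4) ^ 2 := pow_le_pow_left₀ hZ30 hZ3le 2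
        _ = Y * Q4 := by rw [mul_pow, hsY2, Real.sq_sqrt hQ40]
        _ ≤ Y * (sY * (K₀ * sD) ^ 3) := mul_le_mul_of_nonneg_left hQ hY0
        _ = (K₀ * sY * sD) ^ 3 := by rw [← hsY2]; ring
    have hZ23 : Z3 ^ ((1 : ℝ) / (3 / 2)) ≤ K₀ * sY * sD := by
      have e : (1 : ℝ) / (3 / 2) = 2 * ((1 : ℝ) / 3) := by norm_num
      rw [e, Real.rpow_mul hZ30, Real.rpow_two]
      calc (Z3 ^ 2) ^ ((1 : ℝ) / 3) ≤ ((K₀ * sY * sD) ^ 3) ^ ((1 : ℝ) / 3) :=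
            Real.rpow_le_rpow (sq_nonneg _) hn (by norm_num)
        _ = K₀ * sY * sD := hcube _ (by positivity)
    calc M₁ ≤ V6 ^ ((1 : ℝ) / 3) * Z3 ^ ((1 : ℝ) / (3 / 2)) := hHol
      _ ≤ (K₀ ^ 2 * F) * (K₀ * sY * sD) :=
          mul_le_mul hV13 hZ23 (Real.rpow_nonneg hZ30 _) (by positivity)
      _ = K₀ ^ 3 * F * Real.sqrt Y * sD := by rw [hsY]; ring
  have hhigh : 2 * a * (κ * sD) * Real.sqrt M₁ ≤
      ν / 2 * D + 2 * κ ^ 4 * K₀ ^ 6 * c ^ 4 / (ν / 2) ^ 3 * Y * Y :=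
    stretching_count hν2 hκ0 hK₀0 ha hY0 hD0 hF0 le_rfl hM₁le hcpl hFY
  -- ### Step 4: the low part, `M₂ ≤ K₀² Y (2MY + 1)/3`
  have hM₂le : M₂ ≤ K₀ ^ 2 * Y * ((2 * (M * Y) + 1) / 3) := by
    set V6 : ℝ := ∫ x, ‖v x‖ ^ 6 with hV6
    have hV60 : 0 ≤ V6 := integral_nonneg fun x => by positivity
    -- `M₂ = ∫ |v|² (χ |ω|²)`
    set h2 : EuclideanSpace ℝ (Fin 3) → ℝ := fun x => χ x * ‖curl v x‖ ^ 2 with hh2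
    have hh2m : AEStronglyMeasurable h2 volume :=
      (hχm.mul (hωc.norm.measurable.pow_const 2)).aestronglyMeasurable
    have hh20 : ∀ x, 0 ≤ h2 x := fun x => mul_nonneg (hχ0 x) (sq_nonneg _)
    have hM₂eq : M₂ = ∫ x, ‖v x‖ ^ 2 * h2 x :=
      integral_congr_ae (Eventually.of_forall fun x => by
        simp only
        rw [hgl, hh2]; simp only
        rw [hg]; simp only
        rw [mul_pow, mul_pow, hχsq x]; ring)
    -- the low cubic moment `Zlo = ∫ χ |ω|³ ≤ M Y`
    set Zlo : ℝ := ∫ x, χ x * ‖curl v x‖ ^ 3 with hZlo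
    have IZlo : Integrable fun x => χ x * ‖curl v x‖ ^ 3 := by
      refine Iω3.mono' (hχm.mul (hωc.norm.measurable.pow_const 3)).aestronglyMeasurable
        (Eventually.of_forall fun x => ?_)
      rw [Real.norm_of_nonneg (mul_nonneg (hχ0 x) (by positivity))]
      exact (mul_le_mul_of_nonneg_right (hχ1 x) (by positivity)).trans_eq (one_mul _)
    have hZlo0 : 0 ≤ Zlo := integral_nonneg fun x => mul_nonneg (hχ0 x) (by positivity)
    have hZloMY : Zlo ≤ M * Y := by
      rw [hY, ← integral_const_mul]
      exact integral_mono IZlo (Iω.const_mul M) hχω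
    -- Hölder `(3, 3/2)` with `f = |v|²`, `g = χ|ω|²`
    have hpq : (3 : ℝ).HolderConjugate (3 / 2) := by
      rw [Real.holderConjugate_iff]; norm_num
    have hf3 : MemLp (fun x => ‖v x‖ ^ 2) (ENNReal.ofReal 3) volume := by
      refine (integrable_norm_rpow_iff (f := fun x => ‖v x‖ ^ 2)
        ((hvc.norm.pow 2).aestronglyMeasurable) (by simp) ENNReal.ofReal_ne_top).1 ?_
      refine Iv6.congr (Eventually.of_forall fun x => ?_)
      simp only
      rw [ENNReal.toReal_ofReal (by norm_num), Real.norm_of_nonneg (sq_nonneg _),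
        show (3 : ℝ) = ((3 : ℕ) : ℝ) by norm_num, Real.rpow_natCast]
      ring
    have hpt32 : ∀ x, (h2 x) ^ ((3 : ℝ) / 2) = χ x * ‖curl v x‖ ^ 3 := by
      intro x
      rw [hh2]; simp only
      rw [hχ]; simp only
      split_ifs
      · rw [one_mul, one_mul, ← Real.rpow_natCast ‖curl v x‖ 2, ← Real.rpow_mul (norm_nonneg _),
          show ((2 : ℕ) : ℝ) * (3 / 2) = ((3 : ℕ) : ℝ) by norm_num, Real.rpow_natCast]
      · rw [zero_mul, zero_mul, Real.zero_rpow (by norm_num)]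
    have hg32 : MemLp h2 (ENNReal.ofReal (3 / 2)) volume := by
      refine (integrable_norm_rpow_iff hh2m (by simp) ENNReal.ofReal_ne_top).1 ?_
      refine IZlo.congr (Eventually.of_forall fun x => ?_)
      simp only
      rw [ENNReal.toReal_ofReal (by norm_num), Real.norm_of_nonneg (hh20 x), hpt32 x]
    have hHol := integral_mul_le_Lp_mul_Lq_of_nonneg hpq
      (Eventually.of_forall fun x => sq_nonneg ‖v x‖) (Eventually.of_forall hh20) hf3 hg32
    have eV : ∫ x, (‖v x‖ ^ 2) ^ (3 : ℝ) = V6 :=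
      integral_congr_ae (Eventually.of_forall fun x => by
        simp only
        rw [show (3 : ℝ) = ((3 : ℕ) : ℝ) by norm_num, Real.rpow_natCast]
        ring)
    have eZ : ∫ x, (h2 x) ^ ((3 : ℝ) / 2) = Zlo :=
      integral_congr_ae (Eventually.of_forall fun x => by simp only; rw [hpt32 x])
    rw [eV, eZ, ← hM₂eq] at hHol
    have hcube : ∀ y : ℝ, 0 ≤ y → (y ^ 3) ^ ((1 : ℝ) / 3) = y := fun y hy => by
      rw [← Real.rpow_natCast, ← Real.rpow_mul hy]; norm_num
    have hV6le : V6 ≤ (K₀ * Real.sqrt Gop) ^ 6 := integral_norm_pow_six_le hv1 hE hG Iv6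
    have hV13 : V6 ^ ((1 : ℝ) / 3) ≤ K₀ ^ 2 * Y := by
      have h1 : V6 ≤ ((K₀ * Real.sqrt Y) ^ 2) ^ 3 := by
        calc V6 ≤ (K₀ * Real.sqrt Gop) ^ 6 := hV6le
          _ ≤ (K₀ * Real.sqrt Y) ^ 6 :=
              pow_le_pow_left₀ (by positivity)
                (mul_le_mul_of_nonneg_left (Real.sqrt_le_sqrt (hGle.trans hFY)) hK₀0) 6
          _ = ((K₀ * Real.sqrt Y) ^ 2) ^ 3 := by rw [← pow_mul]
      calc V6 ^ ((1 : ℝ) / 3) ≤ (((K₀ * Real.sqrt Y) ^ 2) ^ 3) ^ ((1 : ℝ) / 3) :=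
            Real.rpow_le_rpow hV60 h1 (by norm_num)
        _ = (K₀ * Real.sqrt Y) ^ 2 := hcube _ (sq_nonneg _)
        _ = K₀ ^ 2 * Y := by rw [mul_pow, Real.sq_sqrt hY0]
    -- `Zlo^{2/3} ≤ (2MY + 1)/3` from `Zlo² ≤ (MY)² ≤ ((2MY+1)/3)³`
    set b : ℝ := (2 * (M * Y) + 1) / 3 with hb
    have hb0 : 0 ≤ b := by positivity
    have hZb : Zlo ^ 2 ≤ b ^ 3 := by
      have hMY0 : 0 ≤ M * Y := mul_nonneg hM hY0
      have h1 : Zlo ^ 2 ≤ (M * Y) ^ 2 := pow_le_pow_left₀ hZlo0 hZloMY 2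
      have h2 : (M * Y) ^ 2 ≤ b ^ 3 := by
        rw [hb]
        nlinarith [sq_nonneg (M * Y - 1), hMY0, mul_nonneg hMY0 (sq_nonneg (M * Y - 1))]
      exact h1.trans h2
    have hZ23 : Zlo ^ ((1 : ℝ) / (3 / 2)) ≤ b := by
      have e : (1 : ℝ) / (3 / 2) = 2 * ((1 : ℝ) / 3) := by norm_num
      rw [e, Real.rpow_mul hZlo0, Real.rpow_two]
      calc (Zlo ^ 2) ^ ((1 : ℝ) / 3) ≤ (b ^ 3) ^ ((1 : ℝ) / 3) :=
            Real.rpow_le_rpow (sq_nonneg _) hZb (by norm_num)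
        _ = b := hcube _ hb0
    calc M₂ ≤ V6 ^ ((1 : ℝ) / 3) * Zlo ^ ((1 : ℝ) / (3 / 2)) := hHol
      _ ≤ (K₀ ^ 2 * Y) * b := mul_le_mul hV13 hZ23 (Real.rpow_nonneg hZlo0 _) (by positivity)
      _ = K₀ ^ 2 * Y * ((2 * (M * Y) + 1) / 3) := by rw [hb]
  have hlow : 2 * (sD * (κ * Real.sqrt M₂)) ≤ ν / 2 * D + 2 / ν * (κ ^ 2 * M₂) := by
    have h := two_mul_mul_le_add_sq hν sD (κ * Real.sqrt M₂)
    rw [hsD2, mul_pow, Real.sq_sqrt hM₂0] at h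
    exact h
  have hlow' : 2 / ν * (κ ^ 2 * M₂) ≤
      2 * κ ^ 2 * K₀ ^ 2 / (3 * ν) * Y + 4 * κ ^ 2 * K₀ ^ 2 * M / (3 * ν) * Y * Y := by
    have h := mul_le_mul_of_nonneg_left hM₂le (by positivity : 0 ≤ 2 / ν * κ ^ 2)
    calc 2 / ν * (κ ^ 2 * M₂) = 2 / ν * κ ^ 2 * M₂ := by ring
      _ ≤ 2 / ν * κ ^ 2 * (K₀ ^ 2 * Y * ((2 * (M * Y) + 1) / 3)) := h
      _ = 2 * κ ^ 2 * K₀ ^ 2 / (3 * ν) * Y + 4 * κ ^ 2 * K₀ ^ 2 * M / (3 * ν) * Y * Y := by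
          field_simp
          ring
  -- ### assemble
  have e16 : 2 * κ ^ 4 * K₀ ^ 6 * c ^ 4 / (ν / 2) ^ 3 = 16 * κ ^ 4 * K₀ ^ 6 * c ^ 4 / ν ^ 3 := by
    field_simp; ring
  rw [e16] at hhigh
  linarith [hS, hhigh, hlow, hlow']

end FarhatGrujic2018


namespace FarhatGrujic2018
set_option maxHeartbeats 400000 in -- buildfix (bf3-g25): 160k/180k FAIL, 200k PASS at accept time; line-neutral budget line
/-- **The threshold estimate in the shape of the slab Grönwall** (`C₃ = C₄ = 0`).
[cite: FarhatGrujic2018, Thm 1 (proof p. 5, estimates of I₂′ and I₂″)] -/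
theorem exists_two_mul_integral_stretching_le_of_nearBeltrami_threshold {ν M : ℝ} (c : ℝ)
    (hν : 0 < ν) (hM : 0 ≤ M) :
    ∃ C₁ C₂ : ℝ, 0 ≤ C₁ ∧ 0 ≤ C₂ ∧
      ∀ ⦃v : EuclideanSpace ℝ (Fin 3) → EuclideanSpace ℝ (Fin 3)⦄ (_ : ContDiff ℝ 2 v)
        (_ : VectorCalculus.IsDivFree v) ⦃B₀ : ℝ⦄ (_ : ∀ x, ‖v x‖ ≤ B₀) ⦃B₁ : ℝ⦄
        (_ : ∀ x, ‖fderiv ℝ v x‖ ≤ B₁) (_ : Integrable fun x => ‖v x‖ ^ 2)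
        (_ : Integrable fun x => ‖fderiv ℝ v x‖ ^ 2)
        (_ : Integrable fun x => ‖fderiv ℝ (fderiv ℝ v) x‖ ^ 2) ⦃a : ℝ⦄ (_ : 0 ≤ a)
        (_ : ∀ x, M < ‖curl v x‖ → ‖cross (v x) (curl v x)‖ ≤ a * (‖v x‖ * ‖curl v x‖))
        (_ : a ^ 4 * (∫ x, frobeniusNormSq (fderiv ℝ v x)) ≤ c ^ 4),
        2 * ∫ x, ⟪curl v x, fderiv ℝ v x (curl v x)⟫ ≤
          ν * (∫ x, frobeniusNormSq (fderiv ℝ (curl v) x)) +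
            (C₁ + C₂ * (∫ x, ‖curl v x‖ ^ 2) + 0 * (∫ x, ‖v x‖ ^ 2)) * (∫ x, ‖curl v x‖ ^ 2) +
            0 * (∫ x, frobeniusNormSq (fderiv ℝ v x)) := by
  set K₀ : ℝ := (SNormLESNormFDerivOfEqConst (EuclideanSpace ℝ (Fin 3))
    (volume : Measure (EuclideanSpace ℝ (Fin 3))) 2 : ℝ) with hK₀
  have hK₀0 : 0 ≤ K₀ := NNReal.coe_nonneg _
  refine ⟨2 * ‖curlCLM‖ ^ 2 * K₀ ^ 2 / (3 * ν),
    16 * ‖curlCLM‖ ^ 4 * K₀ ^ 6 * c ^ 4 / ν ^ 3 + 4 * ‖curlCLM‖ ^ 2 * K₀ ^ 2 * M / (3 * ν),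
    by positivity, by positivity, ?_⟩
  intro v hv hdiv B₀ hB₀ B₁ hB₁ hE hG hH a ha hang hcpl
  have h := two_mul_integral_stretching_le_of_nearBeltrami_threshold hν hM hv hdiv hB₀ hB₁ hE hG
    hH ha hang hcpl
  simp only [zero_mul, add_zero]
  rw [hK₀]
  linarith [h]

end FarhatGrujic2018

open FarhatGrujic2018 in
/-- **The a priori `H¹` bound, threshold form**: as `exists_uniform_H1_bound_of_nearBeltrami`, with
the near-Beltrami hypothesis `|u × ω| ≤ a(t)|u||ω|` assumed only in the regions of intense
vorticity `{|ω(·,t)| > M}` (the printed high-vorticity set `S`), `M ≥ 0`.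
[cite: FarhatGrujic2018, Thm 1 (global special case r = ∞; the angle hypothesis is used on S = {|ω| > M} only, proof p. 5); Tao2011, Lemma 8.1] -/
theorem exists_uniform_H1_bound_of_nearBeltrami_threshold {ν T c M : ℝ} (hν : 0 < ν)
    (hT : 0 < T) (hM : 0 ≤ M) {u : ℝ → (EuclideanSpace ℝ (Fin 3)) → (EuclideanSpace ℝ (Fin 3))}
    {p : ℝ → (EuclideanSpace ℝ (Fin 3)) → ℝ}
    (hsol : IsClassicalNSSolutionOn (Ico 0 T) ν 0 u p)
    (hreg : ∀ T'' < T, HasBoundedSobolevNormsOn (Icc 0 T'') u) {a : ℝ → ℝ}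
    (ha : ∀ t ∈ Ico 0 T, 0 ≤ a t)
    (hang : ∀ t ∈ Ico 0 T, ∀ x, M < ‖curl (u t) x‖ →
      ‖cross (u t x) (curl (u t) x)‖ ≤ a t * (‖u t x‖ * ‖curl (u t) x‖))
    (hcpl : ∀ t ∈ Ico 0 T,
      a t * Real.sqrt (Real.sqrt (∫ x, frobeniusNormSq (fderiv ℝ (u t) x))) ≤ c) :
    ∃ A : ℝ, 0 ≤ A ∧ ∀ t ∈ Ico 0 T,
      (∫⁻ x, ‖u t x‖ₑ ^ 2) + (∫⁻ x, ENNReal.ofReal (frobeniusNormSq (fderiv ℝ (u t) x))) ≤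
        ENNReal.ofReal A := by
  obtain ⟨C, hCtop, hTao⟩ := tao_finite_energy_smooth_energy_bound_holds
  obtain ⟨C₁, C₂, hC₁, hC₂, hstr⟩ :=
    exists_two_mul_integral_stretching_le_of_nearBeltrami_threshold c hν hM
  -- the initial energy and enstrophy
  have hreg0 : HasBoundedSobolevNormsOn (Icc 0 (T / 2)) u := hreg (T / 2) (by linarith)
  have h00 : (0 : ℝ) ∈ Icc 0 (T / 2) := ⟨le_rfl, by linarith⟩
  set E₀ : ℝ≥0∞ := ∫⁻ x, ‖u 0 x‖ₑ ^ 2 with hE₀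
  have hE₀top : E₀ < ⊤ := by
    obtain ⟨C0, hC0⟩ := hreg0 0
    refine lt_of_le_of_lt (le_of_eq (lintegral_congr fun x => ?_)) ((hC0 0 h00).trans_lt ENNReal.coe_lt_top)
    rw [← ofReal_norm, ← ofReal_norm, norm_iteratedFDeriv_zero]
  have hCE : C * E₀ < ⊤ := ENNReal.mul_lt_top hCtop hE₀top
  set Ē : ℝ := (C * E₀).toReal with hĒ
  have hĒ0 : 0 ≤ Ē := ENNReal.toReal_nonneg
  set I : ℝ := (C * E₀ / ENNReal.ofReal ν).toReal with hIdef
  have hI0 : 0 ≤ I := ENNReal.toReal_nonneg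
  set Y₀ : ℝ := ∫ x, ‖curl (u 0) x‖ ^ 2 with hY₀
  have hY₀0 : 0 ≤ Y₀ := integral_nonneg fun x => sq_nonneg _
  set Ystar : ℝ := (Y₀ + 0 * I) * Real.exp ((C₁ + 0 * Ē) * T + C₂ * (‖curlCLM‖ ^ 2 * I))
    with hYstar
  have hYstar0 : 0 ≤ Ystar := by positivity
  refine ⟨Ē + Ystar, by positivity, ?_⟩
  intro t ht
  -- a closed slab containing `t`
  set T'' : ℝ := (t + T) / 2 with hT''def
  have htT'' : t < T'' := by rw [hT''def]; linarith [ht.2]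
  have hT''T : T'' < T := by rw [hT''def]; linarith [ht.2]
  have hT''pos : 0 < T'' := lt_of_le_of_lt ht.1 htT''
  have hS : IsClassicalNSSolutionOn (Icc 0 T'') ν 0 u p :=
    hsol.mono (Icc_subset_Ico_right hT''T) (uniqueDiffOn_Icc hT''pos)
  have hB : HasBoundedSobolevNormsOn (Icc 0 T'') u := hreg T'' hT''T
  have htS : t ∈ Icc 0 T'' := ⟨ht.1, htT''.le⟩
  -- Tao's energy class on the slab
  have hfe : ∃ A : ℝ≥0∞, A < ⊤ ∧ ∀ s ∈ Icc 0 T'', ∫⁻ x, ‖u s x‖ₑ ^ 2 ≤ A := by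
    obtain ⟨C0, hC0⟩ := hB 0
    refine ⟨C0, ENNReal.coe_lt_top, fun s hs => ?_⟩
    refine le_trans (le_of_eq (lintegral_congr fun x => ?_)) (hC0 s hs)
    rw [← ofReal_norm, ← ofReal_norm, norm_iteratedFDeriv_zero]
  obtain ⟨hen, hdiss⟩ := hTao ν T'' hν hT''pos u p hS hfe
  have hen' : ∀ s ∈ Icc 0 T'', ∫⁻ x, ‖u s x‖ₑ ^ 2 ≤ ENNReal.ofReal Ē := fun s hs => by
    rw [hĒ, ENNReal.ofReal_toReal hCE.ne]
    exact hen s hs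
  have hdiss' : ∫⁻ s in Ioo 0 T'', ∫⁻ x, ENNReal.ofReal (frobeniusNormSq (fderiv ℝ (u s) x)) ≤
      ENNReal.ofReal I := by
    have hν' : ENNReal.ofReal ν ≠ 0 := (ENNReal.ofReal_pos.2 hν).ne'
    have h1 : ∫⁻ s in Ioo 0 T'', ∫⁻ x, ENNReal.ofReal (frobeniusNormSq (fderiv ℝ (u s) x)) ≤
        C * E₀ / ENNReal.ofReal ν := by
      rw [ENNReal.le_div_iff_mul_le (Or.inl hν') (Or.inl ENNReal.ofReal_ne_top), mul_comm]
      exact hdiss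
    refine h1.trans (le_of_eq ?_)
    rw [hIdef, ENNReal.ofReal_toReal]
    exact (ENNReal.div_lt_top hCE.ne hν').ne
  -- sup bounds on the slab (velocity and gradient)
  obtain ⟨B₀, hB₀⟩ := linfty_bound_of_hasBoundedSobolevNormsOn_holds
    (fun r hr => (hS.contDiff_velocity hr).of_le (by norm_cast)) hB
  obtain ⟨B₁, -, hB₁⟩ := exists_forall_norm_fderiv_le_of_hasBoundedSobolevNormsOn
    (fun r hr => (hS.contDiff_velocity hr).of_le (by norm_cast)) hB
  -- the enstrophy bound on the slab
  have hstrS : ∀ s ∈ Icc 0 T'',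
      2 * ∫ x, ⟪curl (u s) x, fderiv ℝ (u s) x (curl (u s) x)⟫ ≤
        ν * (∫ x, frobeniusNormSq (fderiv ℝ (curl (u s)) x)) +
          (C₁ + C₂ * (∫ x, ‖curl (u s) x‖ ^ 2) + 0 * (∫ x, ‖u s x‖ ^ 2)) *
            (∫ x, ‖curl (u s) x‖ ^ 2) +
          0 * (∫ x, frobeniusNormSq (fderiv ℝ (u s) x)) := by
    intro s hs
    have hsT : s ∈ Ico 0 T := ⟨hs.1, hs.2.trans_lt hT''T⟩
    have hv : ContDiff ℝ ∞ (u s) := hS.contDiff_velocity hs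
    have hv4 : ContDiff ℝ 4 (u s) := hv.of_le (by norm_cast)
    have hv2 : ContDiff ℝ 2 (u s) := hv.of_le (by norm_cast)
    have hfin : ∀ n, ∫⁻ x, ‖iteratedFDeriv ℝ n (u s) x‖ₑ ^ 2 < ⊤ := fun n => by
      obtain ⟨Cn, hCn⟩ := hB n
      exact (hCn s hs).trans_lt ENNReal.coe_lt_top
    have i0 : Integrable fun x => ‖u s x‖ ^ 2 :=
      integrable_sq_norm_of_lintegral_lt_top hv.continuous ((hen' s hs).trans_lt ENNReal.ofReal_lt_top)
    have i1 : Integrable fun x => ‖fderiv ℝ (u s) x‖ ^ 2 := by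
      have h := integrable_sq_norm_of_lintegral_lt_top (hv4.continuous_iteratedFDeriv (by norm_num)) (hfin 1)
      exact h.congr (Eventually.of_forall fun x => by simp only [norm_iteratedFDeriv_one])
    have i2 : Integrable fun x => ‖fderiv ℝ (fderiv ℝ (u s)) x‖ ^ 2 := by
      have h := integrable_sq_norm_of_lintegral_lt_top (hv4.continuous_iteratedFDeriv (by norm_num)) (hfin 2)
      refine h.congr (Eventually.of_forall fun x => ?_)
      show ‖iteratedFDeriv ℝ 2 (u s) x‖ ^ 2 = ‖fderiv ℝ (fderiv ℝ (u s)) x‖ ^ 2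
      rw [← norm_iteratedFDeriv_fderiv, norm_iteratedFDeriv_one]
    have hF0 : 0 ≤ ∫ x, frobeniusNormSq (fderiv ℝ (u s) x) :=
      integral_nonneg fun x => frobeniusNormSq_nonneg _
    have hcpl' : a s ^ 4 * (∫ x, frobeniusNormSq (fderiv ℝ (u s) x)) ≤ c ^ 4 := by
      have h4 : (a s * Real.sqrt (Real.sqrt (∫ x, frobeniusNormSq (fderiv ℝ (u s) x)))) ^ 4 =
          a s ^ 4 * ∫ x, frobeniusNormSq (fderiv ℝ (u s) x) := by
        rw [mul_pow, show (4 : ℕ) = 2 * 2 from rfl, pow_mul (Real.sqrt _),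
          Real.sq_sqrt (Real.sqrt_nonneg _), Real.sq_sqrt hF0]
      rw [← h4]
      exact pow_le_pow_left₀ (mul_nonneg (ha s hsT) (Real.sqrt_nonneg _)) (hcpl s hsT) 4
    exact hstr hv2 (hS.divFree s hs) (hB₀ s hs) (hB₁ s hs) i0 i1 i2 (ha s hsT) (hang s hsT) hcpl'
  have hY := integral_sq_norm_curl_le_of_direction_slab hν hT''pos hS hB hĒ0 hI0 hen' hdiss'
    hC₁ hC₂ le_rfl le_rfl hstrS t htS
  have hYstar_le : ∫ x, ‖curl (u t) x‖ ^ 2 ≤ Ystar := by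
    refine hY.trans ?_
    rw [hYstar]
    refine mul_le_mul_of_nonneg_left (Real.exp_le_exp.2 ?_) (by positivity)
    have : (C₁ + 0 * Ē) * T'' ≤ (C₁ + 0 * Ē) * T :=
      mul_le_mul_of_nonneg_left hT''T.le (by positivity)
    linarith
  -- the `H¹` quantity
  have hvt : ContDiff ℝ ∞ (u t) := hS.contDiff_velocity htS
  have hcurl_int : Integrable fun x => ‖curl (u t) x‖ ^ 2 := by
    have hfin1 : ∫⁻ x, ‖iteratedFDeriv ℝ 1 (u t) x‖ₑ ^ 2 < ⊤ := by
      obtain ⟨C1, hC1⟩ := hB 1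
      exact (hC1 t htS).trans_lt ENNReal.coe_lt_top
    refine integrable_sq_norm_of_lintegral_lt_top (continuous_curl (hvt.of_le (by norm_cast))) ?_
    exact lt_of_le_of_lt (lintegral_curl_sq_le (u t)) (ENNReal.mul_lt_top ENNReal.ofReal_lt_top hfin1)
  have hdc : ∫⁻ x, ENNReal.ofReal (frobeniusNormSq (fderiv ℝ (u t) x)) ≤ ENNReal.ofReal Ystar := by
    refine (lintegral_frobeniusNormSq_fderiv_le_lintegral_sq_norm_curl
      (hvt.of_le (by norm_cast)) (hS.divFree t htS)
      ((hen' t htS).trans_lt ENNReal.ofReal_lt_top)).trans ?_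
    rw [show (∫⁻ x, ‖curl (u t) x‖ₑ ^ 2) = ∫⁻ x, ENNReal.ofReal (‖curl (u t) x‖ ^ 2) from
      lintegral_congr fun x => by rw [← ofReal_norm, ENNReal.ofReal_pow (norm_nonneg _)],
      ← ofReal_integral_eq_lintegral_ofReal hcurl_int (Eventually.of_forall fun x => sq_nonneg _)]
    exact ENNReal.ofReal_le_ofReal hYstar_le
  calc (∫⁻ x, ‖u t x‖ₑ ^ 2) + (∫⁻ x, ENNReal.ofReal (frobeniusNormSq (fderiv ℝ (u t) x)))
      ≤ ENNReal.ofReal Ē + ENNReal.ofReal Ystar := add_le_add (hen' t htS) hdc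
    _ = ENNReal.ofReal (Ē + Ystar) := (ENNReal.ofReal_add hĒ0 hYstar0).symm

/-- **The near-Beltrami depletion criterion in regions of intense vorticity, whole space `ℝ³`**:
as `nearBeltrami_enstrophy_criterion`, but the angle bound `|u × ω| ≤ a(t)|u||ω|` (`sin θ ≤ a(t)`)
is required only where `|ω(x,t)| > M`, for a fixed threshold `M ≥ 0` — the printed regions of high
vorticity `S = {|ω| > M}` on which alone Farhat–Grujić's proof uses the angle hypothesis
(estimate of `I₂″`; on `{|ω| ≤ M}` the estimate of `I₂′` is angle-free) — together with the coupling
`a(t)‖∇u(t)‖₂^{1/2} ≤ c` (any `c`). Conclusion: `HasSobolevExtensionPast ν u T`.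
[cite: FarhatGrujic2018, Thm 1 (p. 4; proof p. 5: splitting {|ω| ≤ M} ∪ {|ω| > M}) — global special case r = ∞, whole space] -/
theorem nearBeltrami_enstrophy_criterion_threshold {ν : ℝ} (hν : 0 < ν) {T : ℝ} (hT : 0 < T)
    {c M : ℝ} (hM : 0 ≤ M) {u : ℝ → (EuclideanSpace ℝ (Fin 3)) → (EuclideanSpace ℝ (Fin 3))}
    {p : ℝ → (EuclideanSpace ℝ (Fin 3)) → ℝ}
    (hsol : IsClassicalNSSolutionOn (Ico 0 T) ν 0 u p)
    (hreg : ∀ T'' < T, HasBoundedSobolevNormsOn (Icc 0 T'') u) {a : ℝ → ℝ}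
    (ha : ∀ t ∈ Ico 0 T, 0 ≤ a t)
    (hang : ∀ t ∈ Ico 0 T, ∀ x, M < ‖curl (u t) x‖ →
      ‖cross (u t x) (curl (u t) x)‖ ≤ a t * (‖u t x‖ * ‖curl (u t) x‖))
    (hcpl : ∀ t ∈ Ico 0 T,
      a t * Real.sqrt (Real.sqrt (∫ x, frobeniusNormSq (fderiv ℝ (u t) x))) ≤ c) :
    HasSobolevExtensionPast ν u T := by
  obtain ⟨A, hA0, hA⟩ :=
    exists_uniform_H1_bound_of_nearBeltrami_threshold hν hT hM hsol hreg ha hang hcpl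
  exact hasSobolevExtensionPast_of_uniform_H1_bound hν hT hsol hreg hA0 hA

/-- **Threshold form, hypothesis near the final time only** (`[t₀, T)`, `0 ≤ t₀ < T`).
[cite: FarhatGrujic2018, Thm 1 (hypothesis on the final time window (t₀ − (2r)², t₀) and on the high-vorticity set S; global-in-space special case)] -/
theorem nearBeltrami_enstrophy_criterion_threshold_of_late {ν : ℝ} (hν : 0 < ν) {T t₀ : ℝ}
    (ht₀ : 0 ≤ t₀) (ht₀T : t₀ < T) {c M : ℝ} (hM : 0 ≤ M)
    {u : ℝ → (EuclideanSpace ℝ (Fin 3)) → (EuclideanSpace ℝ (Fin 3))}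
    {p : ℝ → (EuclideanSpace ℝ (Fin 3)) → ℝ}
    (hsol : IsClassicalNSSolutionOn (Ico 0 T) ν 0 u p)
    (hreg : ∀ T'' < T, HasBoundedSobolevNormsOn (Icc 0 T'') u) {a : ℝ → ℝ}
    (ha : ∀ t ∈ Ico t₀ T, 0 ≤ a t)
    (hang : ∀ t ∈ Ico t₀ T, ∀ x, M < ‖curl (u t) x‖ →
      ‖cross (u t x) (curl (u t) x)‖ ≤ a t * (‖u t x‖ * ‖curl (u t) x‖))
    (hcpl : ∀ t ∈ Ico t₀ T,
      a t * Real.sqrt (Real.sqrt (∫ x, frobeniusNormSq (fderiv ℝ (u t) x))) ≤ c) :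
    HasSobolevExtensionPast ν u T := by
  have hT : 0 < T := lt_of_le_of_lt ht₀ ht₀T
  have hTt : 0 < T - t₀ := by linarith
  have hsol' : IsClassicalNSSolutionOn (Ico 0 (T - t₀)) ν 0 (fun t => u (t + t₀))
      (fun t => p (t + t₀)) := hsol.translate_Ico_zero ht₀
  have hreg' : ∀ T'' < T - t₀, HasBoundedSobolevNormsOn (Icc 0 T'') (fun t => u (t + t₀)) := by
    intro T'' hT'' n
    obtain ⟨C, hC⟩ := hreg (T'' + t₀) (by linarith) n
    exact ⟨C, fun t ht => hC (t + t₀) ⟨by linarith [ht.1], by linarith [ht.2]⟩⟩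
  have ha' : ∀ t ∈ Ico 0 (T - t₀), 0 ≤ (fun t => a (t + t₀)) t :=
    fun t ht => ha (t + t₀) ⟨by linarith [ht.1], by linarith [ht.2]⟩
  have hang' : ∀ t ∈ Ico 0 (T - t₀), ∀ x, M < ‖curl (u (t + t₀)) x‖ →
      ‖cross (u (t + t₀) x) (curl (u (t + t₀)) x)‖ ≤
        (fun t => a (t + t₀)) t * (‖u (t + t₀) x‖ * ‖curl (u (t + t₀)) x‖) :=
    fun t ht => hang (t + t₀) ⟨by linarith [ht.1], by linarith [ht.2]⟩
  have hcpl' : ∀ t ∈ Ico 0 (T - t₀),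
      (fun t => a (t + t₀)) t *
          Real.sqrt (Real.sqrt (∫ x, frobeniusNormSq (fderiv ℝ (u (t + t₀)) x))) ≤ c :=
    fun t ht => hcpl (t + t₀) ⟨by linarith [ht.1], by linarith [ht.2]⟩
  obtain ⟨A, hA0, hA⟩ :=
    exists_uniform_H1_bound_of_nearBeltrami_threshold hν hTt hM hsol' hreg' ha' hang' hcpl'
  have hAu : ∀ t ∈ Ico t₀ T,
      (∫⁻ x, ‖u t x‖ₑ ^ 2) + (∫⁻ x, ENNReal.ofReal (frobeniusNormSq (fderiv ℝ (u t) x))) ≤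
        ENNReal.ofReal A := by
    intro t ht
    have h := hA (t - t₀) ⟨by linarith [ht.1], by linarith [ht.2]⟩
    simp only [sub_add_cancel] at h
    exact h
  obtain ⟨A', hA'0, hA'⟩ := exists_uniform_H1_bound_of_late' ht₀T hreg hA0 hAu
  exact hasSobolevExtensionPast_of_uniform_H1_bound hν hT hsol hreg hA'0 hA'

end Literature.Analysis.FluidPDE
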